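import Mathlib
import HarnessLib
import HarnessLib.Audit
import Summits.AtomisticToContinuum.Statement
import Literature.Analysis.FluidPDE.HardSphereCollisionRecord
import HarnessLib.Audit.Status.Attr

/-!
Route: StiffCollisionalRelaxation

DORMANT since 2026-08-25T08:13:42Z (reconciler: no traction for 7.5 d (last activity item-evidence-added at 2026-08-17T19:05:38Z); parked, not closed — `ledger route dormant route-AtomisticToContinuum-StiffCollisionalRelaxation --off` t) — unstaffed, not closed; items shared with open routes are served there. `ledger route dormant <id> --off` reactivates.

# Route StiffCollisionalRelaxation — stiff relaxation of the exact N-body moment hierarchy — L²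
relaxation of the block kinetic fluxes plus macroscopic relative entropy gives Euler before shocks
(rev 2: collisional coercivity kept as the mechanism, not as an item; rev 4: crux-only deciding
theorem through the dock crux EulerRelEntropyDock; rev 5: after the Statement re-type p126922 the
conjunct's PACKING GUARD replaces DiluteSelfConsistency and the a-priori crux becomes the
profile-uniform AprioriBoundsInBand; rev 6: the `Assembly` item becomes the dock's bookkeeping with
the four statics supports as explicit antecedents, and DiluteSelfConsistency and the
CollisionIsometryCLTAssembly import leave the route)

It suffices to show X = X_micro ∧ X_pde (realising idea card
stiff-relaxation-collisional-coercivity; the macroscopic bookkeeping X_micro ∧ X_pde ⟹ conjunct is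
itself a typed crux, the DOCK EulerRelEntropyDock; since rev 5 (Statement re-type 2026-08-16,
p126922: `HydrodynamicLimit` is the packing-GUARDED conjunct, ∃η₀ outermost, guard ∀t<T ∀x ρ_t(x)σ³
< η₀ on the classical solution) the dock feeds on the Statement's guard and the SHARED
dilute-chamber loophole DiluteSelfConsistency = stmt-AtomisticToContinuum-3091 (expected false) is
no longer in the chain and, since rev 6 (route-repair 2026-08-17), no longer attached to this route
at all; the statics inputs MesoscopicLLN, TimeZeroThermalFloor, HsEntropyUniformlyConvex,
HsFreeEnergyConvex ride as support and are consumed INSIDE the dock's proof as lemmas, never as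
hypotheses of `closes`). All block fields are kernel averages Ū_N = (ρ̄, m̄, Ē)(s, x) = ⟨empirical
measure of Φ_s z, φ_N(· − x) ⊗ (1, v, |v|²/2)⟩ at a mesoscopic scale (N+1)^(−γ), 0 < γ ≤ 1/15, under
the local Gibbs law at reduced density σ < σ₀, ν_N = (N+1)^(1/3) the collision clock.
X_micro: (K1′) FastMomentRelaxation — the block traceless central kinetic stress D and the block
kinetic heat flux q vanish in L²([0,t] × 𝕋³) in probability (Euler closure of the KINETIC fluxes:
momentum flux = ρ̄ū⊗ū + ρ̄θ̄𝟙 + D, energy flux = Ēū + ρ̄θ̄ū + Dū + q exactly). Rev 2: this replaces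
the rev-1 crux CollisionalCoercivity, the STIFF DISSIPATION INEQUALITY (‡) κν_N∫₀ᵗ∫|D|² + ½∫|D(t)|²
≤ ½∫|D(0)|² + ∫₀ᵗ∫⟨D, T_free D⟩ + o(1), which is FALSE AS TYPED (block-centre centring leaves the
collision-invariant resolved-shear floor |D_res|² ≍ N^(−4γ), so κN^(1/3)∫∫|D|² → ∞ for every γ <
1/12 ⊇ (0, 1/15]; past the first shock the smeared shock gives N^(1/3−γ) → ∞ in any kernel centring)
and survives only as the intended MECHANISM behind K1′, to be re-filed recentred and pre-shock as a
child of K1′ once typed; (K2) CollisionalTransferLocality — the collisional momentum / energy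
transfer, DEFINED as the exact residual of the ψ- resp. χ-tested balance law after time-derivative
and free-transport terms, equals ∫₀^τ∫ div ψ · p_c(ρ̄, θ̄) resp. ∫₀^τ∫ ∇χ·ū p_c(ρ̄, θ̄) up to o(1)
uniformly in τ ≤ t, with p_c(ρ, θ) = hsPressure σ ρ θ − ρθ; (K3) AprioriBoundsInBand — before the
first shock (t < T of the LLN-matched classical solution, inside a dilute chamber 2ρσ³ < η₁ whose
threshold η₁ is fixed BEFORE the profiles, like the Statement's η₀; rev 5, item 17749 — the
per-profile rev-3 form AprioriBounds 14827 is its corollary and stays as support with its crux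
chain) a time-averaged ONE-particle exponential velocity moment is bounded and the block density
stays in [c₁, σ⁻³] w.h.p.; (K4) SecondLawInProbability — the block thermodynamic entropy
−∫η_σ(Ū_N(τ)) never drops below its initial value by δ, w.h.p. uniformly in τ ≤ t.
X_pde: RelEntropyStability — Dafermos/DiPerna/Tzavaras relative-entropy stability of a classical
hs-Euler solution on 𝕋³ against ANY bounded measurable field with small initial relative entropy,
approximate GLOBAL entropy inequality, small weak residual tested against Λ = Dη_σ(U_cl), and an
exponentially small hot-cell functional; conclusion in L¹.
X_dock (rev 5): EulerRelEntropyDock — FastMomentRelaxation → CollisionalTransferLocality →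
AprioriBoundsInBand → RelEntropyStability → SecondLawInProbability → HydrodynamicLimit, the
macroscopic relative-entropy bookkeeping as a crux (every hypothesis of RelEntropyStability is
PRODUCED from the four in-probability inputs on a good event, the statics supports being lemmas of
its proof; the chamber / dilute premises come from the Statement's guard with the dock's choice η₀
:= min(η₀^conv, η₁, r_an)/2); with it the deciding theorem is one line of logic over cruxes only.
Lean: `FastMomentRelaxation ∧ CollisionalTransferLocality ∧ AprioriBoundsInBand ∧
SecondLawInProbability ∧ RelEntropyStability ∧ EulerRelEntropyDock`

## Assembly
Deciding theorem (D-0027 §2.1, rev 5, CRUX-ONLY): `theorem closes (hD : EulerRelEntropyDock) (hF :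
FastMomentRelaxation) (h₂ : CollisionalTransferLocality) (h₃ : AprioriBoundsInBand) (h₄ :
RelEntropyStability) (h₅ : SecondLawInProbability) : _root_.HydrodynamicLimit := hD hF h₂ h₃ h₄ h₅`
— every binder is a crux of this route, the conclusion is the sub-problem Statement
`HydrodynamicLimit` (root decl of Summits/AtomisticToContinuum/HydrodynamicLimit/Statement.lean, the
packing-guarded conjunct since p126922) BY NAME; gate-checked rc 0 on the route module (rev 17,
axioms propext / Classical.choice / Quot.sound). History: rev 2/3 bound the `Assembly` item and four
supports (stamped glue.non-crux-hypothesis); rev 4 introduced the dock with `(h₉ :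
DiluteSelfConsistency)` and `(h₃ : AprioriBounds)` among seven binders; rev 5 (Statement re-type)
drops both — the guard the dock receives is exactly what DiluteSelfConsistency used to supply, and a
guard threshold chosen before the profiles can discharge the a-priori crux's dilute premise only if
that crux delivers its threshold η₁ before the profiles too, hence AprioriBoundsInBand (14827
verbatim with ∃η₁ moved in front; aprioriBounds_of_inBand : AprioriBoundsInBand → AprioriBounds,
planner Sketch rc 0). Rev 6 (route-repair rbadge g2, 2026-08-17): the route's single `Assembly` item
is restated (stmt-18061) to the D-0019 shape cruxes + supports → Statement: MesoscopicLLN →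
TimeZeroThermalFloor → HsEntropyUniformlyConvex → HsFreeEnergyConvex → FastMomentRelaxation →
CollisionalTransferLocality → AprioriBoundsInBand → RelEntropyStability → SecondLawInProbability →
HydrodynamicLimit, i.e. the dock's bookkeeping with the four statics supports as EXPLICIT
antecedents — EulerRelEntropyDock → Assembly and Assembly → (the four statics) → EulerRelEntropyDock
are one line each (planner Sketch2 rc 0), so the item isolates the bookkeeping from the statics and
is the natural first target of a dock prover, while `closes` stays crux-only; it replaces the rev-2
chain 11094 (antecedents AprioriBounds 14827 + DiluteSelfConsistency), which no longer reached
`closes` and whose ledger closure record `collisionIsometryCLT_assembly_proof` proves the DIFFERENT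
Prop `CollisionIsometryCLT.Assembly` (a signature-dedup mis-attribution that also pulled
Theorems.CollisionIsometryCLTAssembly into the import cone — import dropped at rev 6), and the
transient rev-6a tautology 18058 (= the type of `closes`, flagged ground.trivial: a one-line
tautology is not an item); with 11094 replaced, DiluteSelfConsistency (stmt-3091) is named by no
decl and is DROPPED from the route. THE ANALYSIS INSIDE THE DOCK (macroscopic: measure theory +
bookkeeping + statics lemmas, no new idea; every hypothesis of RelEntropyStability is produced):
choose the guard threshold η₀ := min(η₀^conv, η₁, r_an)/2 BEFORE the profiles — η₀^conv from
HsEntropyUniformlyConvex (lemma), η₁ from AprioriBoundsInBand, r_an the analyticity radius of f_ex =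
hsExcessFreeEnergy (landed HsEosLowDensity) — so that the guard ρ_t(x)σ³ < η₀ gives the chamber 2ρσ³
< η₀^conv of RelEntropyStability and the dilute premise 2ρσ³ < η₁ of AprioriBoundsInBand
(guard_discharges, Sketch rc 0) and makes Λ = Dη_σ(U_cl) C^∞ (f_ex analytic on the chamber, U_cl
smooth: obligation G3 of the 11094 obligations map); fix profiles; σ₀ := min of the inputs' σ₀; fix
σ, T, a guarded classical solution, Φ, the t = 0 hypothesis, t < T (t = 0 is the hypothesis itself);
restrict the solution to [0,T′], T′ = (t+T)/2, so that min ρ_cl over [0,T′] × 𝕋³ > 0 supplies c₁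
(IsHardSphereEulerSolution restricts to sub-intervals); choose γ = 1/15 and an admissible kernel
family (support AdmissibleKernelsExist, rev 6: smooth torus bumps b∘reprSym); MesoscopicLLN (lemma)
+ the t = 0 hypothesis identify (ρ₀, u₀, θ₀) = (ρ, u, θ)(0) (weak limits are unique under
probability laws, which MesoscopicLLN supplies) and, together with the time-zero thermal floor
TimeZeroThermalFloor (lemma, support 17750 — obligation G1: L²ₓ convergence alone does not control
the relative entropy of cold blocks) and the t = 0 density floor of AprioriBoundsInBand (ii), give
∫h(Ū(0)|U_cl(0)) → 0 in probability; on the intersection G_N of the good events of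
FastMomentRelaxation, CollisionalTransferLocality (applied with the FIXED smooth tests ψ = Λ_m, χ =
Λ_E; pairing Λ with block fields produces the N-dependent tests Λ∗φ̌_N, which differ from Λ by o(1)
in C¹, absorbed because the Irving–Kirkwood residual Cc_N is linear in the test with |Cc_N(ψ)| ≤
C(1+t)‖ψ‖_{C¹} × conserved energy, and p_c(ρ̄, θ̄) is bounded in L¹ on the a-priori event),
AprioriBoundsInBand (chamber (ii) + hot-cell functional from (i) via the cell-level bounds Ē ≤ M
e^(−λM)⟨φ e^(λ|v|²)⟩ and Ē^(3/2)ρ̄^(−1/2) ≤ 2^(−3/2)⟨φ|v|³⟩ ≤ 2M^(3/2)e^(−λM)⟨φ e^(λ|v|²)⟩ on {Ē >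
Mρ̄}, M ≥ 3/(2λ), integrated with ∫ₓ⟨φ(·−x)e^(λ|v|²)⟩ = ⟨μ, e^(λ|v|²)⟩ — RelEntropyStability is then
invoked with λ/2) and SecondLawInProbability, the block field U of the trajectory satisfies every
hypothesis of RelEntropyStability (the weak residual splits EXACTLY, by the hard-sphere trajectory
structure of HardSphereFlow on its good set, into the kinetic defects ∂Λ_m:D + ∂Λ_E·(Dū + q), small
by FastMomentRelaxation and ∫|ū|² ≤ 2E_tot/c₁, and the two collisional residuals of K2), hence
∫ₓ|Ū(t) − U_cl(t)| ≤ ε on G_N with P(G_Nᶜ) → 0; finally χ continuous ⇒ ∫χ d(field) =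
∫(χ∗φ̌_N)·(block field) exactly (Fubini) and χ∗φ̌_N → χ uniformly, so TendstoHydroFieldsAt holds at
t. EOS regularity/convexity hypotheses of RelEntropyStability come from HsEntropyUniformlyConvex and
HsFreeEnergyConvex (lemmas); the Statement's guard keeps U_cl in the chamber.

Rationale: WHY THIS LINE. Read the deterministic hard-sphere gas as a STIFF HYPERBOLIC RELAXATION SYSTEM
(ChenLevermoreLiu1994): the Irving–Kirkwood moment hierarchy of the N-body flow is EXACT
(IrvingKirkwood1950; Spohn1991 Part I (3.6)–(3.8)), its slow part is (ρ̄, m̄, Ē), its fast part W =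
(D, q) obeys an exact balance "free transport + collisional production" with production of size ν_N
= (N+1)^(1/3) → ∞, and realizability / psd-ness of the total stress are identities (Levermore1996);
the microscopic input the macroscopic half needs is therefore only that the fast part relaxes —
FastMomentRelaxation (K1′, rev 2): D, q → 0 in L²ₜ,ₓ in probability — plus locality of the contact
rate (K2, shared in content with EntropyBookkeeping 4515/4516). The INTENDED MECHANISM for K1′ is
the card's one-sided collisional coercivity (collisions are a sink for W: for Maxwell molecules the
production of the pressure deviator is exactly −νP°, IkenberryTruesdell1956; Enskog-level
collisional source of the second moment in Chou2001); its rev-1 typing as the stiff dissipation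
inequality (‡) with block-centre centring and ∀ t > 0 is false on paper (refuters g41-6,
rreview-0815T13-23/ -26: resolved-shear floor N^(1/3−4γ) → ∞ for γ < 1/12, smeared post-shock floor
N^(1/3−γ) → ∞), so rev 2 keys the route on K1′ itself and records the repaired (‡) — recentred,
pre-shock, γ ∈ (1/24, 1/15] — as the foreseen first child of K1′ (TWO-LAYER PLAN). The macroscopic
half imports hyperbolic-PDE stability theory: relative entropy against a Lipschitz solution with the
defect flux as forcing (Dafermos1979; Dafermos2005 Thm 5.2.1; Tzavaras2005; BerthelinVasseur2005 and
BerthelinTzavarasVasseur2009 derive multi-d Euler before shocks from kinetic relaxation models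
exactly this way), run with LOCAL energy balance and only the GLOBAL entropy inequality, which on 𝕋³
is free from Liouville invariance of the global Gibbs law plus large-deviation statics (K4) — no
local-equilibrium closure of the COLLISIONAL currents beyond K2, no classification of stationary
states, no kinetic equation, no density expansion. What the line does that the sibling routes do
not: RelEntropyErgodic/ChaoticMixing/VanishingNoise need Gibbs ergodicity or noise,
DissipativeWeakStrong full weak flux closure + a local second law, OneFlightGossipEngine a windowed
large-deviation engine for the same kinetic currents; here the kinetic input is the bare L²
relaxation of (D, q), the collisional input a typed contact-rate locality, and the price is paid
openly in the a-priori crux (HighMomentumCutoff barrier) — since rev 5 the profile-uniform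
AprioriBoundsInBand — while the density control every dilute route needs is, since the Statement
re-type p126922, the conjunct's own PACKING GUARD (rev 1 had the private NoImplosion, refuted in
print: BuckmasterCaolaboraGomezserrano2025 Thm 1.1, CaolaboraEtAl2025 Thm 1.2 / Rem 1.5; rev 2–4 the
shared DiluteSelfConsistency stmt-3091, expected false); since rev 4 the macroscopic bookkeeping
itself is the typed dock crux EulerRelEntropyDock and `closes` binds cruxes only.

RANKED CRUXES. #2 FastMomentRelaxation (crux; rev 2, was support #8; ledger rank 8) — for all
continuous positive profiles ∃σ₀ ∀σ<σ₀ ∀ flows ∀γ∈(0,1/15] ∀ admissible kernel families φ_N (smooth,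
≥ 0, mass 1, support radius (N+1)^(−γ), φ_N ≤ C(N+1)^(3γ), |∇φ_N| ≤ C(N+1)^(4γ)) ∀t>0 ∀δ>0: P(∫₀ᵗ∫ₓ
Σ_jk D_jk² + |q|² dx ds > δ) → 0 under localGibbsLaw (D = traceless block central kinetic stress, q
= block kinetic heat flux, centred at ū = m̄/ρ̄) — the block traceless kinetic stress and kinetic
heat flux vanish in L²ₜ,ₓ in probability (Euler closure of the KINETIC fluxes); unweighted L²
survives the resolved-shear N^(−4γ) and smeared-shock N^(−γ) floors that sink (‡) (refuter g41-6
scale audit). [difficulty: XL] (why it might fail: it IS dynamical local equilibrium of the kinetic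
fluxes for noiseless hard spheres at fixed σ, known only with noise (OllaVaradhanYau1993) — with (‡)
retired it has no producer in hand; ∀t>0 and ∀ kernels leave no slack; ū, θ̄ are junk on empty
cells.) [OllaVaradhanYau1993, Spohn1991, ChenLevermoreLiu1994, Grad1949]
#3 CollisionalTransferLocality (crux) — (card K2) for all profiles ∃σ₀ ∀σ<σ₀ ∀ flows ∀ admissible
kernels ∀t>0 ∀ smooth space–time test fields ψ (V3-valued), χ (scalar) on [0,t] ∀δ>0: with
probability → 1, for ALL τ ≤ t, |Cc(τ) − ∫₀^τ∫ₓ (div ψ + ∇χ·ū) p_c(ρ̄, θ̄)| ≤ δ, where Cc(τ) — the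
total change of ⟨μ, ψ·v + χ|v|²/2⟩ minus the explicit-time-derivative and free-transport terms — is
BY DEFINITION the collisional momentum-plus-energy transfer tested against (ψ, χ) (the exact
Irving–Kirkwood residual), p_c(ρ, θ) = hsPressure σ ρ θ − ρθ = ρθ(Z(ρσ³) − 1) the collisional
pressure, ū = m̄/ρ̄, θ̄ = (2/3)(Ē/ρ̄ − |m̄|²/(2ρ̄²)); post-shock slabs cost only O(N^(−γ)), so ∀ t >
0 is consistent (rreview-0815T13-26). [difficulty: L] (why it might fail: contact pair statistics
(rate × transfer) are two-body quantities collisions do not relax: out of equilibrium the contact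
value and isotropy of g₂ could lag the block fields beyond o(1); `deriv` junk in Z(η) off the
analytic region bites if dense mesoscopic clusters have positive probability.) [Spohn1991,
IrvingKirkwood1950, ChapmanCowling1970, Resibois1978, Chou2001]
#4 AprioriBoundsInBand (crux; rev 5 = item 17749: the rev-3 PRE-SHOCK + DILUTE-CHAMBER statement
AprioriBounds 14827 with its dilute threshold η₁ quantified BEFORE the profiles, as the guarded
Statement forces — the dock discharges the dilute premise from the guard ρσ³ < η₀ := min(η₀^conv,
η₁, r_an)/2, impossible with a profile-dependent η₁; 14827 =
CollisionIsometryCLT.AprioriBoundsPreShock is its corollary (aprioriBounds_of_inBand) and stays as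
SUPPORT with its live crux chain Cruxes/AprioriBounds/*, whose lines prove 17749 verbatim when their
thresholds are EOS constants; the ∀t>0 ancestor 9519 is held by the PersistentVacuum /
PersistentHotSpot negative lemmas) — ∃η₁>0 ∀ profiles ∃σ₀ ∀σ<σ₀, for every classical hs-Euler
solution on [0,T) whose t = 0 fields are the LLN limit of the local Gibbs laws, ∀ flows, ∀ 0 < t < T
with the solution dilute on [0,t] (2ρ_s(x)σ³ < η₁): (i) ∃λ>0, C: with probability → 1, ∫₀ᵗ (N+1)⁻¹Σᵢ
exp(λ|vᵢ(s)|²) ds ≤ C (time-averaged ONE-particle exponential velocity moment); (ii) for every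
admissible kernel family ∃c₁>0: with probability → 1, for all s ≤ t and all x, c₁ ≤ ρ̄(s,x) and
ρ̄(s,x)σ³ ≤ 1 (no empty and no jammed mesoscopic cell). [difficulty: L] (why it might fail: no
dynamical velocity-tail or anti-clustering estimate is known for hard spheres at fixed density even
before shocks (HighMomentumCutoff barrier; (i) is NOT reachable by entropy transfer against the
invariant Gibbs law); plus uniformity — a producer whose threshold shrinks with ‖a₀‖∞, ‖u₀‖∞ or
1/min θ₀ gives only 14827.) [OllaVaradhanYau1993, NachtergaeleYau2003, Alexander1975, GST2013,
Spohn1991, arXiv:2310.18483]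
#5 RelEntropyStability (crux) — (card K3, the PDE half, deterministic) for σ, η₀, c₁, λ, C > 0 with
the EOS regularity/convexity of the statics supports (f_ex C² on (0, η₀), η_σ = −ρs strongly convex
on dilute chambers, convex up to ρσ³ = 1.1), every classical hs-Euler solution U_cl = (ρ, ρu, E) on
[0,T) with c₁ ≤ ρ and 2ρσ³ < η₀, every t₁ < T and ε > 0 admit δ > 0 such that every bounded jointly
measurable x-continuous field U with values in {c₁ ≤ ρ, ρσ³ ≤ 1, |m|² < 2ρE} on [0,t₁], initial
relative entropy ≤ δ, approximate global entropy inequality (+δ, τ ≤ t₁), hot-cell functional ∫₀^t₁∫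
1(E > Mρ)(E^(3/2)ρ^(−1/2) + E + ρ) ≤ C e^(−λM) (M ≥ 1) and weak residual ≤ δ against Λ = Dη_σ(U_cl),
satisfies ∫ₓ|U − U_cl|(τ) ≤ ε for all τ ≤ t₁ (Dafermos 5.2.14 on 𝕋³ with the defect as forcing,
Gronwall on {E ≤ Mρ} with constant e^(C√M t) beaten by e^(−λM)). [difficulty: L] (why it might fail:
print needs compact values; the Gronwall rate on {E ≤ Mρ} ∪ dense cells must be o(M) (claimed C√M)
to be absorbed by the e^(−λM) hot-cell allowance with λ FIXED — a rate ≳ M breaks δ-uniformity for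
t₁ > λ/C; cubic flux vs quadratic entropy is open.) [Dafermos1979, Dafermos2005, Tzavaras2005,
BerthelinVasseur2005, BerthelinTzavarasVasseur2009, BrezinaFeireisl2018, SaintRaymond2009]
#6 SecondLawInProbability (crux) — (card "free input (ii)" of invariant-gibbs-entropy-bookkeeping,
made a crux) for all profiles ∃σ₀ ∀σ<σ₀ ∀ flows ∀ admissible kernels ∀t>0 ∀δ>0: with probability → 1
under localGibbsLaw, for ALL τ ≤ t, ∫ₓ η_σ(Ū_N(τ, x)) dx ≤ ∫ₓ η_σ(Ū_N(0, x)) dx + δ, with η_σ(ρ, m,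
E) = −ρ(3/2 log θ − log ρ − hsExcessFreeEnergy(ρσ³)), θ = (2/3)(E/ρ − |m|²/(2ρ²)) (the entropy of
stmt-0817); intended proof: conserved relative entropy w.r.t. the INVARIANT global Gibbs law G,
Hölder (p ↓ 1) on dP₀/dG against an LD upper bound for block fields under G, union over e^(o(N))
instants. [difficulty: M] (why it might fail: needs a speed-N LD UPPER bound for the N^(−γ)-block
entropy functional of the hard-sphere Gibbs law incl. dense/cold blocks (rate = Ruelle free energy):
weak-topology LDPs miss {∫η > c}; E_G[e^(pN∫η)] = ∞ on cold cells, so Hölder acts on dP₀/dG only;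
plus the sup over τ ≤ t. Unprinted.) [Ruelle1969, GeorgiiZessin1993, Varadhan1993EntropyMethods,
KipnisLandim1999, OllaVaradhanYau1993, Spohn1991]
#10 EulerRelEntropyDock (crux, rev 5 = item 17823: THE DOCK; rank 10 only so that it renders after
the cruxes it quotes; attemptable now, all its inputs being hypotheses) — FastMomentRelaxation →
CollisionalTransferLocality → AprioriBoundsInBand → RelEntropyStability → SecondLawInProbability →
HydrodynamicLimit (the GUARDED conjunct): the macroscopic relative-entropy bookkeeping of the
thesis' ## Assembly paragraph as a typed statement — the guard threshold η₀ := min(η₀^conv, η₁,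
r_an)/2 is chosen before the profiles and discharges the chamber of RelEntropyStability and the
dilute premise of AprioriBoundsInBand (guard_discharges) and puts Λ = Dη_σ(U_cl) in C^∞ (G3); every
hypothesis of RelEntropyStability is PRODUCED from the four in-probability inputs on a good event
G_N with P(G_Nᶜ) → 0, and L¹-closeness of the block fields gives TendstoHydroFieldsAt; the statics
MesoscopicLLN / TimeZeroThermalFloor (G1) / HsEntropyUniformlyConvex / HsFreeEnergyConvex and the
landed HsEosLowDensity + StiffCollisionalRelaxationAssembly* helpers are LEMMAS of its proof, not
antecedents (crux-only rule); the rev-4 dock 14956 (with DiluteSelfConsistency, AprioriBounds) is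
its corollary (dock_of_dock'). [difficulty: L] (why it might fail: interface risk only — a
hypothesis of RelEntropyStability the inputs do not produce as typed (G1 t=0 thermal floor is a
statics lemma; G3 needs η₀ below the analyticity radius; strict |m̄|² < 2ρ̄Ē; x-continuity / joint
measurability of block fields along the flow); a mismatch is repaired by restating the
producer/consumer pair, not by abandoning the line.) [Dafermos2005, OllaVaradhanYau1993,
KipnisLandim1999, Spohn1991, BerthelinVasseur2005]
#9 supports (statics, unranked; LEMMAS of the dock): MesoscopicLLN (low-density cluster expansion:
block fields AT TIME 0 converge in L²(𝕋³) in probability to (ρ₀, ρ₀u₀, ρ₀(|u₀|²/2 + 3θ₀/2)), local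
Gibbs laws are probability measures) [M; Ruelle1969, LebowitzPenrose1964, Spohn1991];
TimeZeroThermalFloor (rev 5, item 17750; obligation G1 of the 11094 prover verdict: w.h.p. no
mesoscopic block is cold at t = 0, 2ρ̄Ē − ‖m̄‖² ≥ c₂ρ̄² ∀x) [M; Spohn1991, Ruelle1969];
HsEntropyUniformlyConvex (hsExcessFreeEnergy C² on (0, η₀), η_σ strongly convex on each chamber —
from the landed HsEosLowDensity) [M; Ruelle1969, Dafermos2005]; HsFreeEnergyConvex (Ruelle1969 Thm
3.4.4 convexity up to ρσ³ = 1.1, perspective lemma) [M]; AprioriBounds (14827, the per-profile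
corollary of #4, see there); AdmissibleKernelsExist (rev 6, support: for every γ ∈ (0, 1/15] an
admissible — smooth, ≥ 0, mass 1, support radius (N+1)^(−γ), sup ≤ C(N+1)^(3γ), ‖∇‖ ≤ C(N+1)^(4γ),
even — kernel family exists; the instantiation lemma with which the dock / Assembly use the ∀-kernel
cruxes at γ = 1/15 non-vacuously; smooth radial bump of radius min((N+1)^(−γ), 1/4) through reprSym
or the tree's Torus.isSmooth_periodize) [S; Spohn1991]; DiluteSelfConsistency (SHARED 3091; crux of
ImplosionLoophole / ImplosionDichotomy; expected FALSE for focusing profiles — BCG Thm 1.1, CGSS Thm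
1.2, refuter glue DenseExcursion → ¬DSC, NegGlue3091.lean) LEFT THIS ROUTE at rev 6 (route-repair
rbadge g2, 2026-08-17): unnecessary after the re-type p126922, as KILL CRITERIA foresaw, unused by
`closes` since rev 5, and kept attached at rev 5 only because the rev-2 `Assembly` 11094 named its
decl — keeping an expected-false statement attached would only expose the route to a BROKEN flip
[arXiv:2208.09445, arXiv:2310.05325]. Assembly (rev 6 = item 18061, kind assembly, rank 1):
MesoscopicLLN → TimeZeroThermalFloor → HsEntropyUniformlyConvex → HsFreeEnergyConvex →
FastMomentRelaxation → CollisionalTransferLocality → AprioriBoundsInBand → RelEntropyStability →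
SecondLawInProbability → HydrodynamicLimit — the dock's bookkeeping with the four statics supports
as explicit antecedents (cruxes + supports → Statement; EulerRelEntropyDock → Assembly and Assembly
+ the four statics → EulerRelEntropyDock are one-liners, planner Sketch2 rc 0, the second to be
landed --supports EulerRelEntropyDock; not a binder of `closes`; size L; the natural first target of
a dock prover) [Dafermos2005, KipnisLandim1999, Spohn1991]; it replaces the rev-2 chain 11094
(antecedents AprioriBounds 14827 + DiluteSelfConsistency), which reached nothing since rev 4 and
carried a mis-attributed closure record (collisionIsometryCLT_assembly_proof proves the different
Prop CollisionIsometryCLT.Assembly), and the transient rev-6a tautology 18058 (= the type of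
`closes`, flagged ground.trivial).
RETIRED AT REV 2 (dropped, never refiled): CollisionalCoercivity (stmt-9517, (‡) mis-stated),
CoercivityGlue (stmt-9523), NoImplosion (stmt-9527, paper-refuted); REPLACED: AprioriBounds 9519 →
14827 (rev 3), EulerRelEntropyDock 14956 → 17823 (rev 5), Assembly 9528 → 11094 (rev 3) → 18058 →
18061 (rev 6); DROPPED AT REV 6: DiluteSelfConsistency 3091 (shared; its other routes keep it) and
the explicit import Theorems.CollisionIsometryCLTAssembly (used by no decl).

TWO-LAYER PLAN. Since rev 6 the Assembly item 18061 already separates the dock from the statics: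
EulerRelEntropyDock ⇐ Assembly + MesoscopicLLN + TimeZeroThermalFloor + HsEntropyUniformlyConvex +
HsFreeEnergyConvex (glue one line, Sketch2; not filed as a split — land it --supports
EulerRelEntropyDock). Recommended first split of the bookkeeping itself (11094 prover verdict, not
filed): EulerRelEntropyDock (or Assembly) ⇐ MacroBookkeeping (deterministic Dafermos bookkeeping, L)
→ ProbabilisticGlue (good events + statics lemmas, M) → EulerRelEntropyDock, with
TimeZeroThermalFloor / MesoscopicLLN as the statics children's inputs. Foreseen glued splits (k ≤ 3,
depth 1), filed only after a crux moves: FastMomentRelaxation ⇐ CollisionalCoercivityPreShock →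
KineticTransportBudget → FastMomentRelaxation, where CollisionalCoercivityPreShock is the REPAIRED
(‡) — for profiles, σ < σ₀, every classical hs-Euler solution on [0,T) and t < T, γ ∈ (1/24, 1/15],
even kernels, the stiff dissipation inequality for the RECENTRED fast moments D♮ = D − ρ̄[∇ū M_φ
∇ūᵀ]° (M_φ = m_φh²𝟙, h = (N+1)^(−γ)) and q♮ = q − (5/2)ρ̄ m_φ h² ∇ū·∇θ̄, residual floors O(h⁴) (γ >
1/24) against the collision-martingale budget N^(9γ−2/3) (γ < 2/27); card K1(a),(b): angular Doeblin
minorisation of the collision normal + partner diversity — and KineticTransportBudget is the rev-1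
CoercivityGlue estimate (transport bound N^(4γ) = o(N^(1/3)), moments from AprioriBoundsInBand(i));
AprioriBoundsInBand ⇐ OneParticleExpMoment → NoEmptyNoJammedCell → AprioriBoundsInBand (uniform η₁);
RelEntropyStability ⇐ RelEntropyIdentityTorus (Dafermos (5.2.14) with defect forcing) →
GronwallWithHotCells → RelEntropyStability; SecondLawInProbability ⇐ BlockFieldLDUpperBound (statics
under the global Gibbs law) → LiouvilleHoelderTransfer → SecondLawInProbability.

KILL CRITERIA. A refutation of FastMomentRelaxation (a flow family / profile along which the block
kinetic stress or heat flux keeps L²ₜ,ₓ mass ≥ δ with probability bounded below — persistent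
counter-streaming at scales ≫ N^(−γ), or fat velocity tails feeding |q|²) closes the route
`refuted:FastMomentRelaxation`: every Euler-closure line needs it. A refutation of the repaired (‡)
child kills the card's MECHANISM but not K1′; K1′ then waits for another producer
(OneFlightGossipEngine's KineticCurrentsWindowLDUniform is the nearest sibling) and the route goes
dormant, not closed. A refutation of CollisionalTransferLocality forces a pivot to a two-body
contact-statistics crux shared with card limit-collision-measure-chaos. (PersistentVacuum /
PersistentHotSpot constructions refute the ∀t>0 item 9519, not the pre-shock fork 14827.) A
refutation of AprioriBoundsInBand(i) (fat velocity tails with positive probability) kills every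
local-energy-balance line incl. this one — pivot to the Brezina–Feireisl bookkeeping (global energy
+ LOCAL entropy inequality, DissipativeWeakStrong's 0824); a refutation of its UNIFORMITY only
(14827 true, 17749 false: the dilute threshold must shrink with the profiles) sends the route back
to a profile-dependent guard, i.e. to a Statement-level question (the conjunct's η₀ is
profile-uniform). A refutation of DiluteSelfConsistency no longer touches this route (out of the
chain since rev 5, out of the route since rev 6). A ‘refutation’ of EulerRelEntropyDock can only be
an interface defect (a hypothesis of RelEntropyStability the inputs do not produce as typed): repair
by restating the producer/consumer pair in tenure, never a close. FluxClosure (stmt-0823) +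
EntropyAdmissibility (0824) proved elsewhere moot K1′/K2.

NOT DECOMPOSED YET. The repaired coercivity inequality (recentring, pre-shock binders, γ-window
above) is designed but NOT filed: typing it needs ∇ū of the block velocity and the
classical-solution binders inside the in-probability event (~60 lines of signature, to be set once
K1′ is claimed: workitem add … --name CollisionalCoercivityPreShock, then --split
FastMomentRelaxation); the split of K2 into contact-rate locality and isotropy of contact
statistics; the constants κ(σ, c₁, θ_min) and c₁(t); the kernel-existence lemma is FILED since rev 6
(support AdmissibleKernelsExist); the measurability / càdlàg bookkeeping of block fields along the
flow and the test-field bookkeeping (fixed tests Λ vs Λ∗φ̌_N, rreview-0815T13-26) inside the dock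
(helper lemmas, --supports EulerRelEntropyDock); the IsProbabilityMeasure guard, which the
in-probability items do not state and the dock takes from MesoscopicLLN; the dock's split
MacroBookkeeping / ProbabilisticGlue (TWO-LAYER PLAN); EOS convexity beyond the virial radius is
filed (HsFreeEnergyConvex) but not split; the velocity-tail mechanism (cards
apriori-tails-and-rattlers, fast-particle-energy-cascade) behind AprioriBoundsInBand(i).

CHEAPEST FALSIFIER. For the line: a kit/MD regression at reduced density φ = 0.05–0.2 (card
refutation (i)) of the window-averaged block traceless kinetic stress and heat flux against N at
fixed γ — the L²ₜ,ₓ mass of (D, q) must decay like max(N^(−4γ), N^(−2/3), N^(3γ−1)) pre-shock on a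
sheared profile (u₀ = (A sin 2πx₂, 0, 0)); a plateau kills K1′. For the mechanism: the desk check of
the sign structure behind (‡) WAS RUN (refuter g41-28, k1_pairing.py on stmt-9517): Maxwell
molecules reproduce Ikenberry–Truesdell (rates 2, 4/3) but 4-atom / 4-beam hard-sphere cell laws
give a production pairing of the wrong sign — any repaired (‡) must be ν_coll-weighted,
time-integrated, in probability along the dynamics. For the loophole: settled in print against the
σ- and T-uniform form (BCG arXiv:2208.09445 Thm 1.1, CGSS arXiv:2310.05325 Thm 1.2 / Rem 1.5); the
shared DiluteSelfConsistency is attacked by route ImplosionLoophole (DenseExcursion).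

NUMBERS. ν_N = (N+1)^(1/3) collisions per particle per unit macroscopic time at fixed (N+1)ε³ = σ³;
mesoscopic exponent 0 < γ ≤ 1/15 (transport bound N^(4γ) = o(N^(1/3)); jump noise N^(3γ−2/3),
martingale fluctuation N^(9γ−2/3)); local-equilibrium floors of the block-centred fast moments:
resolved shear |D_res|² ≍ N^(−4γ), viscous N^(−2/3), sampling N^(3γ−1), smeared shock N^(−γ)
(refuter g41-6) — harmless unweighted, fatal with the N^(1/3) weight unless recentred (O(h⁴) ⇒ γ >
1/24) and pre-shock; block cap ρ̄σ³ ≤ 1 (freezing ≈ 0.94, close packing √2); convexity used up to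
ρσ³ = 1.1; Z(η) = 1 + (2π/3)η + O(η²) (LebowitzPenrose1964); Maxwell-molecule deviator relaxation
rate ν, heat-flux rate (2/3)ν (IkenberryTruesdell1956); hot-cell transfer inside the dock: on {Ē >
Mρ̄}, Ē ≤ M e^(−λM)⟨φ e^(λ|v|²)⟩ (M ≥ 1/λ) and Ē^(3/2)ρ̄^(−1/2) ≤ 2^(−3/2)⟨φ|v|³⟩ ≤ 2^(−1/2) M^(3/2)
e^(−λM)⟨φ e^(λ|v|²)⟩ (M ≥ 3/(2λ)), so RelEntropyStability is invoked with λ/2; dock guard threshold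
η₀ := min(η₀^conv, η₁, r_an)/2; items after rev 6: 13 (6 cruxes FastMomentRelaxation /
CollisionalTransferLocality / AprioriBoundsInBand / RelEntropyStability / SecondLawInProbability /
EulerRelEntropyDock = the 6 binders of `closes`; 6 supports MesoscopicLLN / TimeZeroThermalFloor /
HsEntropyUniformlyConvex / HsFreeEnergyConvex / AprioriBounds 14827 / AdmissibleKernelsExist; 1
assembly 18061 = the dock's bookkeeping with the four statics as antecedents); rev 5 had 13 (+
DiluteSelfConsistency 3091, Assembly 11094), rev 4 had 11 with 7 binders. Conforming re-file of the
retired route StiffRelaxation.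

DEFINITION REQUESTS. None filed: block fields, the free-transport derivative (deriv along
Literature.Analysis.FluidPDE.freeFlight) and the Irving–Kirkwood collisional residuals are inlined
with `let` over existing declarations (empiricalDensityField/MomentumField/EnergyField,
empiricalMeasure, HardSphereFlow.flow, Torus.gradient/divergence/timeDeriv/partialDeriv, hsPressure,
hsExcessFreeEnergy); a shared Theorems-side definition of mesoscopic block fields (and of D♮, q♮)
would shorten K1′/K2/K4 and the dock — the natural first request once a grounder stamps them. No
cite facts requested.

Novelty: Searches (2026-08-15): `lit search --source crossref "Tzavaras relative entropy hyperbolic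
relaxation"` (8: Tzavaras2005, LattanzioTzavaras2013, doi:10.4310/cms.2014.v12.n6.a2
Miroshnikov–Trivisa, Christoforou–Tzavaras 2017/2018); `… crossref "hydrodynamic limit particle
system compressible Euler relaxation relative entropy"` (8, none deriving Euler from particles by
relaxation structure); `… crossref "kinetic equation to multidimensional isentropic gas dynamics
before shocks relative entropy"` (BerthelinVasseur2005, Berthelin–Bouchut 2002); `… crossref "moment
closure realizability Levermore kinetic"` (Levermore1996, doi:10.1063/1.869849); `… crossref "From
Newton's second law to Euler's equations of perfect fluids"` (HankwanIacobelli2021: mean-field,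
monokinetic, modulated energy); `… crossref "hydrodynamic limit kinetic Cucker-Smale flocking
relative entropy"` (KarperMelletTrivisa2014); `… crossref "Moment methods particle systems hard
spheres pressure tensor relaxation kinetic"` (Chou2001: Enskog collisional source of the second
moment; doi:10.1063/1.4769503 R13 for hard spheres); `lit search --source zbmath "hyperbolic
conservation laws stiff relaxation terms entropy"` (ChenLevermoreLiu1994 + relaxation numerics);
`lit frontier AtomisticToContinuum --since 2020` (30 rows, none on relaxation structure of N-body
moments); `lit bridges AtomisticToContinuum --cross any` (30; doi:10.1090/bull/1650 survey); `ledger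
negatives --problem AtomisticToContinuum` (0); `lit vsearch "c  [refs: 10.4310/cms.2014.v12.n6.a2, 10.1063/1.869849, 10.1063/1.4769503, 10.1090/bull/1650, doi:10.4310/cms.2014.v12.n6.a2, doi:10.1063/1.869849, doi:10.1063/1.4769503, doi:10.1090/bull/1650, book:woods1993-introduction-kinetic-theory-gases-magnetoplasmas, book:saint-raymond2009-hydrodynamic-limits-boltzmann-equation, Tzavaras2005, LattanzioTzavaras2013, BerthelinVasseur2005, Levermore1996, HankwanIacobel]

Barriers (technique_class: stiff-relaxation relative-energy relative-entropy): - technique_class: stiff-relaxation relative-energy relative-entropy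
- Literature.Barriers.AtomisticToContinuum.ShockFormationBarrier: respected, not evaded — the
comparison state is the classical solution on [0,T) (RelEntropyStability needs a Lipschitz U_cl);
nothing is claimed past T, which is exactly the conjunct's scope; the foreseen coercivity child of
FastMomentRelaxation is pre-shock by design (rev 2).
- Literature.Barriers.AtomisticToContinuum.WildSolutionsBarrier: not met — no tightness /
measure-valued identification; uniqueness is used only against the classical solution through
relative entropy, never convex integration.
- Literature.Barriers.AtomisticToContinuum.HighMomentumCutoffBarrier: applies (true kinetic energy,
cubic energy flux) and is NOT evaded: it is isolated in AprioriBounds(i) as an order-ONE,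
time-averaged, in-probability exponential moment (far weaker than OVY's order-N exponential moments,
still a genuine dynamical input not reachable by entropy transfer), and RelEntropyStability is
engineered (e^(−λM) hot-cell functional) to need exactly that; the bet is that one-particle tails
are provable where N-particle ones are not.
- Literature.Barriers.AtomisticToContinuum.HighMomentumCutoffBarrierNarrow: evaded by the
bookkeeping, not defeated — no entropy-inequality / Gibbs-large-deviation control of the CUBIC
energy current is attempted (its exponential moments under Maxwellian references are infinite,
`setLIntegral_exp_cubic_eq_top`, which is the narro

History (route lifecycle, newest last):
- 2026-08-16T06:33:36Z · rev 7: restated AprioriBounds (stmt-AtomisticToContinuum-9519) — @note.txt (planner-rchoice-AtomisticToContinuum-StiffColl-e59269da-0)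
- 2026-08-16T23:38:51Z · rev 15: restated EulerRelEntropyDock (stmt-AtomisticToContinuum-14956) — route-repair (Statement re-type p126922, packing-guarded conjunct) step 3b/4: RESTATE the dock EulerRelEntropyDock — DiluteSelfConsistency leaves the chain, the (planner-rrepair-AtomisticToContinuum-StiffColl-f9da2891-0)
- 2026-08-16T23:39:26Z · AUTO-CRUX (edit): AprioriBoundsInBand — hypotheses of the deciding theorem that nothing in the route derives are cruxes (planner-rrepair-AtomisticToContinuum-StiffColl-f9da2891-0)
- 2026-08-16T23:58:52Z · rev 20: restated Assembly (stmt-AtomisticToContinuum-11094 proved) — route-repair rbadge g2 (needs_repair crux-cap stamp of 23:39:26Z was transient: 14827/3091 re-badged support at 23:39:38Z, over_cap false; 6 cruxes = the 6 bind (planner-rbadge-AtomisticToContinuum-StiffColli-e8e21589-g2-0)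
- 2026-08-16T23:59:20Z · rev 21: dropped DiluteSelfConsistency — route-repair rbadge g2 step B/3: DROP the shared DiluteSelfConsistency (stmt-3091) from THIS route — since rev 5 it is neither a binder of closes nor named by a (planner-rbadge-AtomisticToContinuum-StiffColli-e8e21589-g2-0)
- 2026-08-17T00:02:51Z · rev 23: restated Assembly (stmt-AtomisticToContinuum-18058) — route-repair rbadge g2 step A'/3: the rev-6a Assembly 18058 (= literally the type of closes) is flagged ground.trivial (intros; aesop) and blocks READY — a taut (planner-rbadge-AtomisticToContinuum-StiffColli-e8e21589-g2-0)
- 2026-08-17T14:06:31Z · rev 33: dropped MesoscaleCollisionalEnergyFluxLaw — crux-strategist cstrat-9518-s2: DEDUP step 1/2 — drop stmt-18214 MesoscaleCollisionalEnergyFluxLaw (Kq under `open … in`, filed at rev 32): the identical statem (planner-cstrat-stmt-AtomisticToContinuum-9518-s2-0)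
- 2026-08-25T08:13:42Z · DORMANT — reconciler: no traction for 7.5 d (last activity item-evidence-added at 2026-08-17T19:05:38Z); parked, not closed — `ledger route dormant route-AtomisticToConti (operator:999:4099021)

sub-problem: HydrodynamicLimit · status: dormant · opened planner-plancard-AtomisticToContinuum-Hydrody-8730473f-0 2026-08-15T13:59:54Z · rev 34 · ledger route-AtomisticToContinuum-StiffCollisionalRelaxation
GENERATED by the gate from the ledger (D-0016/17). Provers cite these decls: `theorem foo : Summit.AtomisticToContinuum.HydrodynamicLimit.Theses.StiffCollisionalRelaxation.<Decl> := …` in Summits/AtomisticToContinuum/HydrodynamicLimit/Theorems/<Name>.lean.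
-/

namespace Summit.AtomisticToContinuum.HydrodynamicLimit.Theses.StiffCollisionalRelaxation

open scoped BigOperators Topology Manifold Classical MeasureTheory ProbabilityTheory Matrix InnerProductSpace ComplexConjugate ContinuousMap
open Filter Set Function TopologicalSpace MeasureTheory

attribute [summit_statement] _root_.HydrodynamicLimit

/-- item stmt-AtomisticToContinuum-9518 · crux · rank 3 · open · by planner
why it might fail: Contact statistics (rate×transfer) are two-body and not relaxed by collisions: out of equilibrium g₂(σ⁺) and the isotropy of contact normals may lag the block fields by O(1) at fixed σ; on cells with η₀≤ρ̄σ³≤1, p_c uses Z=1+η·deriv f_ex under mere convexity (freezing kink ≈0.94 ⇒ deriv junk 0).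
sources: Spohn1991 Part I §3.2 (3.8)–(3.10), (3.15)–(3.17) (currents and their local-equilibrium averages; 'beyond scope' p.46), IrvingKirkwood1950, ChapmanCowling1970 §16.4, VanbeijerenErnst1973 (modified Enskog: collisional transfer with local g₂), Resibois1978, Chou2001
[crux] (card K2) for all profiles ∃σ₀ ∀σ<σ₀ ∀ flows ∀ admissible kernels ∀t>0 ∀ smooth space–time
test fields ψ (V3-valued), χ (scalar) on [0,t] ∀δ>0: with probability → 1, for ALL τ ≤ t, |Cc(τ) −
∫₀^τ∫ₓ (div ψ + ∇χ·ū) p_c(ρ̄, θ̄)| ≤ δ, where Cc(τ) = [⟨μ, ψ·v + χ|v|²/2⟩]₀^τ − ∫₀^τ(⟨μ, ∂_sψ·v +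
∂_sχ|v|²/2⟩ + T_free⟨μ, ψ·v + χ|v|²/2⟩) ds is BY DEFINITION the collisional momentum-plus-energy
transfer tested against (ψ, χ) (the exact Irving–Kirkwood residual of the tested balance laws after
the time-derivative and free-transport terms; χ = 0 resp. ψ = 0 give the momentum resp. energy
statements), p_c(ρ, θ) = hsPressure σ ρ θ − ρθ = ρθ(Z(ρσ³) − 1) is the collisional pressure, ū =
m̄/ρ̄ and θ̄ = (2/3)(Ē/ρ̄ − |m̄|²/(2ρ̄²)); i.e. the line-averaged collisional stress is isotropic
and a local function of the block fields, the collisional energy flux is p_c ū, and there is no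
collisional heat flux at leading order. [difficulty: L] -/
@[route_item "route-AtomisticToContinuum-StiffCollisionalRelaxation", crux]
def CollisionalTransferLocality : Prop :=
  ∀ (a₀ θ₀ : (UnitAddTorus (Fin 3)) → ℝ) (u₀ : (UnitAddTorus (Fin 3)) → (EuclideanSpace ℝ (Fin 3))), Continuous a₀ → Continuous θ₀ → Continuous u₀ → (∀ x, 0 < a₀ x) → (∀ x, 0 < θ₀ x) → ∃ σ₀ : ℝ, 0 < σ₀ ∧ ∀ σ : ℝ, 0 < σ → σ < σ₀ → ∀ Φ : (N : ℕ) → Literature.Analysis.FluidPDE.HardSphereFlow (Literature.Analysis.FluidPDE.Torus.geometry (Fin 3)) (Literature.MathematicalPhysics.KineticTheory.hsDiameter σ N) (N + 1), ∀ (γ C : ℝ) (φ : ℕ → (UnitAddTorus (Fin 3)) → ℝ), 0 < γ → γ ≤ 1 / 15 → ((∀ N, Literature.Analysis.FunctionSpaces.Torus.IsSmooth (φ N)) ∧ (∀ N y, 0 ≤ φ N y) ∧ (∀ N, ∫ y, φ N y = 1) ∧ (∀ (N : ℕ) y, ((N : ℝ) + 1) ^ (-γ) ≤ Literature.Analysis.FluidPDE.Torus.euclidDist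 y 0 → φ N y = 0) ∧ (∀ (N : ℕ) y, φ N y ≤ C * ((N : ℝ) + 1) ^ (3 * γ)) ∧ (∀ (N : ℕ) y, ‖Literature.Analysis.FunctionSpaces.Torus.gradient (φ N) y‖ ≤ C * ((N : ℝ) + 1) ^ (4 * γ))) → let ρb := fun (N : ℕ) (z : Literature.Analysis.FluidPDE.Config (N + 1) (Fin 3) (UnitAddTorus (Fin 3))) (x : (UnitAddTorus (Fin 3))) => Literature.MathematicalPhysics.KineticTheory.empiricalDensityField z (fun y => φ N (y - x)); let mb := fun (N : ℕ) (z : Literature.Analysis.FluidPDE.Config (N + 1) (Fin 3) (UnitAddTorus (Fin 3))) (x : (UnitAddTorus (Fin 3))) => Literature.MathematicalPhysics.KineticTheory.empiricalMomentumField z (fun y => φ N (y - x)); let Eb := fun (N : ℕ) (z : Literature.Analysis.FluidPDE.Config (N + 1) (Fin 3) (UnitAddTorus (Fin 3))) (x : (UnitAddTorus (Fin 3))) => Literature.MathematicalPhysics.KineticTheory.empiricalEnergyField z (fun y => φ N (y - x)); let ub := fun (N : ℕ) (z : Literature.Analysis.FluidPDE.Config (N + 1) (Fin 3) (UnitAddTorus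 (Fin 3))) (x : (UnitAddTorus (Fin 3))) => (ρb N z x)⁻¹ • mb N z x; let θb := fun (N : ℕ) (z : Literature.Analysis.FluidPDE.Config (N + 1) (Fin 3) (UnitAddTorus (Fin 3))) (x : (UnitAddTorus (Fin 3))) => 2 / 3 * (Eb N z x / ρb N z x - ‖mb N z x‖ ^ 2 / (2 * ρb N z x ^ 2)); let pc := fun (r th : ℝ) => Literature.MathematicalPhysics.KineticTheory.hsPressure σ r th - r * th; ∀ t : ℝ, 0 < t → ∀ (ψ : ℝ → (UnitAddTorus (Fin 3)) → (EuclideanSpace ℝ (Fin 3))) (χ : ℝ → (UnitAddTorus (Fin 3)) → ℝ), Literature.Analysis.FunctionSpaces.Torus.IsSmoothSpaceTimeOn (Icc 0 t) ψ → Literature.Analysis.FunctionSpaces.Torus.IsSmoothSpaceTimeOn (Icc 0 t) χ → let O := fun (N : ℕ) (s : ℝ) (z : Literature.Analysis.FluidPDE.Config (N + 1) (Fin 3) (UnitAddTorus (Fin 3))) => ∫ y, ((∑ j, ψ s y.1 j * y.2 j) + χ s y.1 * (‖y.2‖ ^ 2 / 2)) ∂(Literature.Analysis.FluidPDE.empiricalMeasure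 z); let Cc := fun (N : ℕ) (z : Literature.Analysis.FluidPDE.Config (N + 1) (Fin 3) (UnitAddTorus (Fin 3))) (τ : ℝ) => O N τ ((Φ N).flow τ z) - O N 0 ((Φ N).flow 0 z) - ∫ s in Icc 0 τ, ((∫ y, ((∑ j, Literature.Analysis.FunctionSpaces.Torus.timeDeriv ψ s y.1 j * y.2 j) + Literature.Analysis.FunctionSpaces.Torus.timeDeriv χ s y.1 * (‖y.2‖ ^ 2 / 2)) ∂(Literature.Analysis.FluidPDE.empiricalMeasure ((Φ N).flow s z))) + deriv (fun r : ℝ => O N s (Literature.Analysis.FluidPDE.freeFlight (Literature.Analysis.FluidPDE.Torus.geometry (Fin 3)) r ((Φ N).flow s z))) 0); ∀ δ : ℝ, 0 < δ → Tendsto (fun N : ℕ => Literature.MathematicalPhysics.KineticTheory.localGibbsLaw σ a₀ u₀ θ₀ N (Φ N) {z | ∃ τ ∈ Icc 0 t, δ < |Cc N z τ - ∫ s in Icc 0 τ, ∫ x, (Literature.Analysis.FunctionSpaces.Torus.divergence (ψ s) x + ∑ j, Literature.Analysis.FunctionSpaces.Torus.gradient (χ s) x j * ub N ((Φ N).flow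 s z) x j) * pc (ρb N ((Φ N).flow s z) x) (θb N ((Φ N).flow s z) x)|}) atTop (𝓝 0)

/-- item stmt-AtomisticToContinuum-17749 · crux (kind.auto-crux: conjecture-grade) · rank 4 · open · by planner
why it might fail: As 14827: no dynamical velocity-tail / anti-clustering estimate for hard spheres at fixed σ is known even pre-shock (HighMomentumCutoff barrier); plus UNIFORMITY — a producer whose dilute threshold η₁ shrinks with ‖a₀‖∞, ‖u₀‖∞ or 1/min θ₀ yields only the per-profile 14827.
sources: OllaVaradhanYau1993 §1 p.525 (kinetic energy modified: large velocities not handled), NachtergaeleYau2003 §2.3 Assumption II.1, Literature.Barriers.AtomisticToContinuum.HighMomentumCutoffBarrier, Literature.Barriers.AtomisticToContinuum.HighMomentumCutoffBarrierNarrow, Spohn1991 Part I Ch. 3 §3.2–3.3, Summit.AtomisticToContinuum.HydrodynamicLimit.Theorems.AdiabatCeiling.aprioriBounds_of_KRC_GVT_MOB (landed per-profile reduction of 14827)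
[crux] (rev 5, route-repair after the Statement re-type p126922) = AprioriBounds (stmt-14827, KEPT
in the route as support: it is this statement's per-profile corollary, aprioriBounds_of_inBand in
the planner's Sketch.lean rc 0; = CollisionIsometryCLT.AprioriBoundsPreShock) with the dilute
threshold η₁ quantified BEFORE the profiles: ∃η₁>0 ∀ continuous positive profiles ∃σ₀>0 ∀σ<σ₀, for
every classical hs-Euler solution (ρ,u,θ) on [0,T) whose t = 0 fields are the LLN limit of the local
Gibbs laws (IsHardSphereEulerSolution + TendstoHydroFieldsAt … 0), for every flow family and every 0
< t < T with the solution dilute on [0,t] (∀ s ≤ t ∀ x, 2ρ_s(x)σ³ < η₁): (i) ∃λ>0, C: with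
probability → 1, ∫₀ᵗ (N+1)⁻¹Σᵢ exp(λ|vᵢ(s)|²) ds ≤ C (time-averaged ONE-particle exponential
velocity moment); (ii) for every admissible kernel family (γ ≤ 1/15) ∃c₁>0: with probability → 1,
for all s ≤ t and all x, c₁ ≤ ρ̄(s,x) and ρ̄(s,x)σ³ ≤ 1 (no empty and no jammed mesoscopic cell) —
bodies (i)/(ii) verbatim those of 14827. WHY THE QUANTIFIER MOVE: the re-typed conjunct fixes its
packing threshold before the profiles (∃η₀ outermost) and the dock (EulerRelEntropyDock rev 5)
discharges this item's dilute prem -/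
@[route_item "route-AtomisticToContinuum-StiffCollisionalRelaxation", crux]
def AprioriBoundsInBand : Prop :=
  ∃ η₁ : ℝ, 0 < η₁ ∧ ∀ (a₀ θ₀ : (UnitAddTorus (Fin 3)) → ℝ) (u₀ : (UnitAddTorus (Fin 3)) → (EuclideanSpace ℝ (Fin 3))), Continuous a₀ → Continuous θ₀ → Continuous u₀ → (∀ x, 0 < a₀ x) → (∀ x, 0 < θ₀ x) → ∃ σ₀ : ℝ, 0 < σ₀ ∧ ∀ σ : ℝ, 0 < σ → σ < σ₀ → ∀ (T : ℝ) (ρ θ : ℝ → (UnitAddTorus (Fin 3)) → ℝ) (u : ℝ → (UnitAddTorus (Fin 3)) → (EuclideanSpace ℝ (Fin 3))), Literature.MathematicalPhysics.KineticTheory.IsHardSphereEulerSolution σ T ρ u θ → ∀ Φ : (N : ℕ) → Literature.Analysis.FluidPDE.HardSphereFlow (Literature.Analysis.FluidPDE.Torus.geometry (Fin 3)) (Literature.MathematicalPhysics.KineticTheory.hsDiameter σ N) (N + 1), Literature.MathematicalPhysics.KineticTheory.TendstoHydroFieldsAt (fun N => Literature.MathematicalPhysics.KineticTheory.localGibbsLaw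 σ a₀ u₀ θ₀ N (Φ N)) Φ ρ u θ 0 → ∀ t : ℝ, 0 < t → t < T → (∀ s ∈ Icc 0 t, ∀ x, 2 * ρ s x * σ ^ 3 < η₁) → (∃ lam Cexp : ℝ, 0 < lam ∧ Tendsto (fun N : ℕ => Literature.MathematicalPhysics.KineticTheory.localGibbsLaw σ a₀ u₀ θ₀ N (Φ N) {z | Cexp < ∫ s in Icc 0 t, ∫ y, Real.exp (lam * ‖y.2‖ ^ 2) ∂(Literature.Analysis.FluidPDE.empiricalMeasure ((Φ N).flow s z))}) atTop (𝓝 0)) ∧ (∀ (γ C : ℝ) (φ : ℕ → (UnitAddTorus (Fin 3)) → ℝ), 0 < γ → γ ≤ 1 / 15 → ((∀ N, Literature.Analysis.FunctionSpaces.Torus.IsSmooth (φ N)) ∧ (∀ N y, 0 ≤ φ N y) ∧ (∀ N, ∫ y, φ N y = 1) ∧ (∀ (N : ℕ) y, ((N : ℝ) + 1) ^ (-γ) ≤ Literature.Analysis.FluidPDE.Torus.euclidDist y 0 → φ N y = 0) ∧ (∀ (N : ℕ) y, φ N y ≤ C * ((N : ℝ) + 1) ^ (3 * γ)) ∧ (∀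 (N : ℕ) y, ‖Literature.Analysis.FunctionSpaces.Torus.gradient (φ N) y‖ ≤ C * ((N : ℝ) + 1) ^ (4 * γ))) → ∃ c₁ : ℝ, 0 < c₁ ∧ Tendsto (fun N : ℕ => Literature.MathematicalPhysics.KineticTheory.localGibbsLaw σ a₀ u₀ θ₀ N (Φ N) {z | ∃ s ∈ Icc 0 t, ∃ x : (UnitAddTorus (Fin 3)), Literature.MathematicalPhysics.KineticTheory.empiricalDensityField ((Φ N).flow s z) (fun y => φ N (y - x)) < c₁ ∨ 1 < Literature.MathematicalPhysics.KineticTheory.empiricalDensityField ((Φ N).flow s z) (fun y => φ N (y - x)) * σ ^ 3}) atTop (𝓝 0))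

/-- item stmt-AtomisticToContinuum-9520 · crux · rank 5 · open · by planner
why it might fail: Print needs compact values; unprinted is the constants trade-off: the Gronwall rate on {E≤Mρ} ∪ dense cells must be o(M) (claimed C√M via linear growth of h) to be absorbed by the e^{−λM} hot-cell allowance, λ FIXED; rate ≳M breaks δ-uniformity for t₁>λ/C. Cubic flux vs quadratic entropy: open.
sources: Dafermos2005 Thm 5.2.1 (PDF p.126) + (5.2.14) (p.128), page-read by grounders g15-0/g13-42/g17-12 2026-08-15, Dafermos1979, Tzavaras2005, BerthelinVasseur2005 §3 (relative entropy with defect from a kinetic relaxation model), BerthelinTzavarasVasseur2009, BrezinaFeireisl2018 (complete Euler: relative energy needs the dissipative/measure-valued framework because the energy flux is uncontrolled)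
[crux] (card K3, the PDE half, deterministic) for σ, η₀, c₁, λ, C > 0 with hsExcessFreeEnergy C² on
(0, η₀), η_σ = −ρs strongly convex (modulus m(E₁) > 0) on each chamber {c₁/2 < ρ, ρσ³ < η₀, |m|² <
2ρE, E < E₁} and convex on {0 < ρ, ρσ³ < 11/10, |m|² < 2ρE}, every classical hs-Euler solution U_cl
= (ρ, ρu, E) on [0,T) with c₁ ≤ ρ and 2ρσ³ < η₀, every t₁ < T and ε > 0 admit δ > 0 such that every
bounded jointly measurable field U : ℝ → 𝕋³ → ℝ×V3×ℝ, continuous in x, with values in {c₁ ≤ ρ, ρσ³ ≤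
1, |m|² < 2ρE} on [0,t₁], initial relative entropy ∫h(U(0)|U_cl(0)) ≤ δ, approximate global entropy
inequality ∫η_σ(U(τ)) ≤ ∫η_σ(U(0)) + δ (τ ≤ t₁), hot-cell functional ∫₀^t₁∫ 1(E >
Mρ)(E^(3/2)ρ^(−1/2) + E + ρ) ≤ C e^(−λM) for all M ≥ 1, and weak residual |[∫Λ·U]₀^τ − ∫₀^τ∫(∂_sΛ·U
+ Σ_j ∂_jΛ·F_j(U))| ≤ δ (τ ≤ t₁) against Λ = Dη_σ(U_cl) with the hs-Euler fluxes F_j, satisfies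
∫ₓ(|ρ̄−ρ| + |m̄−ρu| + |Ē−E|)(τ) ≤ ε for all τ ≤ t₁ (Dafermos 5.2.14 on 𝕋³ with the defect as
forcing, Gronwall on {E ≤ Mρ} with constant e^(C√M t) beaten by e^(−λM), linear growth of h on
dense/hot cells). [difficulty: L] -/
@[route_item "route-AtomisticToContinuum-StiffCollisionalRelaxation", crux]
def RelEntropyStability : Prop :=
  ∀ (σ η₀ c₁ lam Cexp : ℝ), 0 < σ → 0 < η₀ → 0 < c₁ → 0 < lam → let ησ := fun U : ℝ × (EuclideanSpace ℝ (Fin 3)) × ℝ => -(U.1 * (3 / 2 * Real.log (2 / 3 * (U.2.2 / U.1 - ‖U.2.1‖ ^ 2 / (2 * U.1 ^ 2))) - Real.log U.1 - Literature.MathematicalPhysics.KineticTheory.hsExcessFreeEnergy (U.1 * σ ^ 3))); ContDiffOn ℝ 2 Literature.MathematicalPhysics.KineticTheory.hsExcessFreeEnergy (Set.Ioo 0 η₀) → (∀ E₁ : ℝ, ∃ m : ℝ, 0 < m ∧ ConvexOn ℝ {U : ℝ × (EuclideanSpace ℝ (Fin 3)) × ℝ | c₁ / 2 < U.1 ∧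 U.1 * σ ^ 3 < η₀ ∧ ‖U.2.1‖ ^ 2 < 2 * U.1 * U.2.2 ∧ U.2.2 < E₁} (fun U : ℝ × (EuclideanSpace ℝ (Fin 3)) × ℝ => ησ U - m * (U.1 ^ 2 + ‖U.2.1‖ ^ 2 + U.2.2 ^ 2))) → ConvexOn ℝ {U : ℝ × (EuclideanSpace ℝ (Fin 3)) × ℝ | 0 < U.1 ∧ U.1 * σ ^ 3 < 11 / 10 ∧ ‖U.2.1‖ ^ 2 < 2 * U.1 * U.2.2} ησ → ∀ (T : ℝ) (ρ θ : ℝ → (UnitAddTorus (Fin 3)) → ℝ) (u : ℝ → (UnitAddTorus (Fin 3)) → (EuclideanSpace ℝ (Fin 3))), Literature.MathematicalPhysics.KineticTheory.IsHardSphereEulerSolution σ T ρ u θ → (∀ t ∈ Ico 0 T, ∀ x, c₁ ≤ ρ t x ∧ 2 * ρ t x * σ ^ 3 < η₀) → let Ucl := fun (s : ℝ) (x : (UnitAddTorus (Fin 3))) => ((ρ s x, ρ s x • u s x, Literature.MathematicalPhysics.KineticTheory.totalEnergyDensity (ρ s x) (u s x) (θ s x)) : ℝ × (EuclideanSpace ℝ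 (Fin 3)) × ℝ); let Λ := fun (s : ℝ) (x : (UnitAddTorus (Fin 3))) => fderiv ℝ ησ (Ucl s x); let Fl := fun (j : Fin 3) (U : ℝ × (EuclideanSpace ℝ (Fin 3)) × ℝ) => ((U.2.1 j, (U.2.1 j / U.1) • U.2.1 + Literature.MathematicalPhysics.KineticTheory.hsPressure σ U.1 (2 / 3 * (U.2.2 / U.1 - ‖U.2.1‖ ^ 2 / (2 * U.1 ^ 2))) • EuclideanSpace.single j (1 : ℝ), (U.2.2 + Literature.MathematicalPhysics.KineticTheory.hsPressure σ U.1 (2 / 3 * (U.2.2 / U.1 - ‖U.2.1‖ ^ 2 / (2 * U.1 ^ 2)))) * U.2.1 j / U.1) : ℝ × (EuclideanSpace ℝ (Fin 3)) × ℝ); ∀ t₁ ∈ Ico 0 T, ∀ ε : ℝ, 0 < ε → ∃ δ : ℝ, 0 < δ ∧ ∀ U : ℝ → (UnitAddTorus (Fin 3)) → ℝ × (EuclideanSpace ℝ (Fin 3)) × ℝ, Measurable (Function.uncurry U) → (∃ B : ℝ, ∀ s x, ‖U s x‖ ≤ B) → (∀ s, Continuous (U s)) → (∀ s ∈ Icc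 0 t₁, ∀ x, c₁ ≤ (U s x).1 ∧ (U s x).1 * σ ^ 3 ≤ 1 ∧ ‖(U s x).2.1‖ ^ 2 < 2 * (U s x).1 * (U s x).2.2) → (∫ x, (ησ (U 0 x) - ησ (Ucl 0 x) - Λ 0 x (U 0 x - Ucl 0 x))) ≤ δ → (∀ τ ∈ Icc 0 t₁, (∫ x, ησ (U τ x)) ≤ (∫ x, ησ (U 0 x)) + δ) → (∀ M : ℝ, 1 ≤ M → (∫ s in Icc 0 t₁, ∫ x, (if M * (U s x).1 < (U s x).2.2 then (U s x).2.2 ^ (3 / 2 : ℝ) / Real.sqrt ((U s x).1) + (U s x).2.2 + (U s x).1 else 0)) ≤ Cexp * Real.exp (-(lam * M))) → (∀ τ ∈ Icc 0 t₁, |(∫ x, Λ τ x (U τ x)) - (∫ x, Λ 0 x (U 0 x)) - ∫ s in Icc 0 τ, ∫ x, (Literature.Analysis.FunctionSpaces.Torus.timeDeriv Λ s x (U s x) + ∑ j, Literature.Analysis.FunctionSpaces.Torus.partialDeriv j (Λ s) x (Fl j (U s x)))| ≤ δ) → ∀ τ ∈ Icc 0 t₁, (∫ x, (|(U τ x).1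 - ρ τ x| + ‖(U τ x).2.1 - ρ τ x • u τ x‖ + |(U τ x).2.2 - Literature.MathematicalPhysics.KineticTheory.totalEnergyDensity (ρ τ x) (u τ x) (θ τ x)|)) ≤ ε

/-- item stmt-AtomisticToContinuum-9521 · crux · rank 6 · open · by planner
why it might fail: Needs a speed-N LD UPPER bound for the N^(−γ)-block entropy functional of the hard-sphere Gibbs law incl. dense/cold blocks (rate = Ruelle free energy): weak-topology LDPs miss {∫η>c} (weakly dense); E_G[e^{pN∫η}]=∞ (cold cells), so Hölder acts on dP₀/dG only; plus sup over τ≤t. Unprinted.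
sources: Ruelle1969 Thm 3.4.4 (PDF p.51–52: canonical free energy exists and is convex in ρ below close packing), page-read by grounders g14-13/g15-0/g15-36, GeorgiiZessin1993 (LDP for marked Gibbs point fields — macroscopic, weak topology), Georgii1995 (equivalence of ensembles for classical particle systems), Varadhan1993EntropyMethods §5 (Hamiltonian systems and Euler: entropy/LD transfer against the invariant Gibbs law), KipnisLandim1999 App. 1 Prop 8.2 (entropy inequality; vendored fact p3903 per grounder g13-42), OllaVaradhanYau1993 §3–4
[crux] (card "free input (ii)" of invariant-gibbs-entropy-bookkeeping, made a crux) for all profiles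
∃σ₀ ∀σ<σ₀ ∀ flows ∀ admissible kernels ∀t>0 ∀δ>0: with probability → 1 under localGibbsLaw, for ALL
τ ≤ t, ∫ₓ η_σ(Ū_N(τ, x)) dx ≤ ∫ₓ η_σ(Ū_N(0, x)) dx + δ, with η_σ(ρ, m, E) = −ρ(3/2 log θ − log ρ −
hsExcessFreeEnergy(ρσ³)), θ = (2/3)(E/ρ − |m|²/(2ρ²)) (the entropy of stmt-0817); intended proof:
relative entropy w.r.t. the INVARIANT global Gibbs law G is conserved, dP_t/dG = (dP₀/dG)∘Φ_(−t) is
an exponential of a linear empirical functional of conserved type, Hölder with exponent p ↓ 1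
against the large-deviation upper bound for kernel-smoothed block fields under G gives P_t(entropy
deficit > δ) ≤ e^(−Nκ(δ)); union over e^(o(N)) instants + modulus of continuity. [difficulty: M] -/
@[route_item "route-AtomisticToContinuum-StiffCollisionalRelaxation", crux]
def SecondLawInProbability : Prop :=
  ∀ (a₀ θ₀ : (UnitAddTorus (Fin 3)) → ℝ) (u₀ : (UnitAddTorus (Fin 3)) → (EuclideanSpace ℝ (Fin 3))), Continuous a₀ → Continuous θ₀ → Continuous u₀ → (∀ x, 0 < a₀ x) → (∀ x, 0 < θ₀ x) → ∃ σ₀ : ℝ, 0 < σ₀ ∧ ∀ σ : ℝ, 0 < σ → σ < σ₀ → ∀ Φ : (N : ℕ) → Literature.Analysis.FluidPDE.HardSphereFlow (Literature.Analysis.FluidPDE.Torus.geometry (Fin 3)) (Literature.MathematicalPhysics.KineticTheory.hsDiameter σ N) (N + 1), ∀ (γ C : ℝ) (φ : ℕ → (UnitAddTorus (Fin 3)) → ℝ), 0 < γ → γ ≤ 1 / 15 → ((∀ N, Literature.Analysis.FunctionSpaces.Torus.IsSmooth (φ N)) ∧ (∀ N y, 0 ≤ φ N y) ∧ (∀ N,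 ∫ y, φ N y = 1) ∧ (∀ (N : ℕ) y, ((N : ℝ) + 1) ^ (-γ) ≤ Literature.Analysis.FluidPDE.Torus.euclidDist y 0 → φ N y = 0) ∧ (∀ (N : ℕ) y, φ N y ≤ C * ((N : ℝ) + 1) ^ (3 * γ)) ∧ (∀ (N : ℕ) y, ‖Literature.Analysis.FunctionSpaces.Torus.gradient (φ N) y‖ ≤ C * ((N : ℝ) + 1) ^ (4 * γ))) → let ρb := fun (N : ℕ) (z : Literature.Analysis.FluidPDE.Config (N + 1) (Fin 3) (UnitAddTorus (Fin 3))) (x : (UnitAddTorus (Fin 3))) => Literature.MathematicalPhysics.KineticTheory.empiricalDensityField z (fun y => φ N (y - x)); let mb := fun (N : ℕ) (z : Literature.Analysis.FluidPDE.Config (N + 1) (Fin 3) (UnitAddTorus (Fin 3))) (x : (UnitAddTorus (Fin 3))) => Literature.MathematicalPhysics.KineticTheory.empiricalMomentumField z (fun y => φ N (y - x)); let Eb := fun (N : ℕ) (z : Literature.Analysis.FluidPDE.Config (N + 1) (Fin 3) (UnitAddTorus (Fin 3))) (x : (UnitAddTorus (Fin 3))) => Literature.MathematicalPhysics.KineticTheory.empiricalEnergyField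 z (fun y => φ N (y - x)); let ησ := fun U : ℝ × (EuclideanSpace ℝ (Fin 3)) × ℝ => -(U.1 * (3 / 2 * Real.log (2 / 3 * (U.2.2 / U.1 - ‖U.2.1‖ ^ 2 / (2 * U.1 ^ 2))) - Real.log U.1 - Literature.MathematicalPhysics.KineticTheory.hsExcessFreeEnergy (U.1 * σ ^ 3))); ∀ t : ℝ, 0 < t → ∀ δ : ℝ, 0 < δ → Tendsto (fun N : ℕ => Literature.MathematicalPhysics.KineticTheory.localGibbsLaw σ a₀ u₀ θ₀ N (Φ N) {z | ∃ τ ∈ Icc 0 t, (∫ x, ησ (ρb N ((Φ N).flow 0 z) x, mb N ((Φ N).flow 0 z) x, Eb N ((Φ N).flow 0 z) x)) + δ < ∫ x, ησ (ρb N ((Φ N).flow τ z) x, mb N ((Φ N).flow τ z) x, Eb N ((Φ N).flow τ z) x)}) atTop (𝓝 0)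

/-- item stmt-AtomisticToContinuum-9522 · crux · rank 8 · open · by planner
why it might fail: It IS dynamical local equilibrium of the kinetic fluxes for noiseless hard spheres at fixed σ (known only with noise, OVY93); rev 2 leaves it no producer; unweighted L² survives the N^(−4γ) shear / N^(−γ) shock floors that sink (‡), but ∀t>0, ∀ kernels, ū=m̄/ρ̄ junk on empty cells leave no slack.
sources: OllaVaradhanYau1993, Spohn1991, ChenLevermoreLiu1994, Grad1949, SaintRaymond2009 Ch. 5–6 (kinetic-scaling analogue only), ledger notes stmt-AtomisticToContinuum-9522: refuter g41-6 14:09Z (scale audit harmless, 'physical heart of the conjunct'), grounders g15-0 / g13-42 14:39–14:41Z (NEW/OPEN, no print)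
[support] (interface consumed by the Assembly) for all profiles ∃σ₀ ∀σ<σ₀ ∀ flows ∀ admissible
kernels ∀t>0 ∀δ>0: P(∫₀ᵗ∫ₓ |D|² + |q|² dx ds > δ) → 0 — the block traceless kinetic stress and
kinetic heat flux vanish in L²ₜ,ₓ in probability (Euler closure of the KINETIC fluxes: momentum flux
= ρ̄ū⊗ū + ρ̄θ̄𝟙 + D exactly, energy flux = Ēū + ρ̄θ̄ū + Dū + q exactly). [deps:
CollisionalCoercivity, AprioriBounds] [difficulty: L] -/
@[route_item "route-AtomisticToContinuum-StiffCollisionalRelaxation", crux]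
def FastMomentRelaxation : Prop :=
  ∀ (a₀ θ₀ : (UnitAddTorus (Fin 3)) → ℝ) (u₀ : (UnitAddTorus (Fin 3)) → (EuclideanSpace ℝ (Fin 3))), Continuous a₀ → Continuous θ₀ → Continuous u₀ → (∀ x, 0 < a₀ x) → (∀ x, 0 < θ₀ x) → ∃ σ₀ : ℝ, 0 < σ₀ ∧ ∀ σ : ℝ, 0 < σ → σ < σ₀ → ∀ Φ : (N : ℕ) → Literature.Analysis.FluidPDE.HardSphereFlow (Literature.Analysis.FluidPDE.Torus.geometry (Fin 3)) (Literature.MathematicalPhysics.KineticTheory.hsDiameter σ N) (N + 1), ∀ (γ C : ℝ) (φ : ℕ → (UnitAddTorus (Fin 3)) → ℝ), 0 < γ → γ ≤ 1 / 15 → ((∀ N, Literature.Analysis.FunctionSpaces.Torus.IsSmooth (φ N)) ∧ (∀ N y, 0 ≤ φ N y) ∧ (∀ N, ∫ y, φ N y = 1) ∧ (∀ (N : ℕ) y, ((N : ℝ) + 1) ^ (-γ) ≤ Literature.Analysis.FluidPDE.Torus.euclidDist y 0 → φ N y = 0) ∧ (∀ (N : ℕ) y, φ N y ≤ C * ((N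 : ℝ) + 1) ^ (3 * γ)) ∧ (∀ (N : ℕ) y, ‖Literature.Analysis.FunctionSpaces.Torus.gradient (φ N) y‖ ≤ C * ((N : ℝ) + 1) ^ (4 * γ))) → let ρb := fun (N : ℕ) (z : Literature.Analysis.FluidPDE.Config (N + 1) (Fin 3) (UnitAddTorus (Fin 3))) (x : (UnitAddTorus (Fin 3))) => Literature.MathematicalPhysics.KineticTheory.empiricalDensityField z (fun y => φ N (y - x)); let mb := fun (N : ℕ) (z : Literature.Analysis.FluidPDE.Config (N + 1) (Fin 3) (UnitAddTorus (Fin 3))) (x : (UnitAddTorus (Fin 3))) => Literature.MathematicalPhysics.KineticTheory.empiricalMomentumField z (fun y => φ N (y - x)); let ub := fun (N : ℕ) (z : Literature.Analysis.FluidPDE.Config (N + 1) (Fin 3) (UnitAddTorus (Fin 3))) (x : (UnitAddTorus (Fin 3))) => (ρb N z x)⁻¹ • mb N z x; let D := fun (N : ℕ) (z : Literature.Analysis.FluidPDE.Config (N + 1) (Fin 3) (UnitAddTorus (Fin 3))) (x : (UnitAddTorus (Fin 3))) (j k : Fin 3) => (∫ y, φ N (y.1 - x) * ((y.2 j - ub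 N z x j) * (y.2 k - ub N z x k)) ∂(Literature.Analysis.FluidPDE.empiricalMeasure z)) - (if j = k then (∑ l : Fin 3, ∫ y, φ N (y.1 - x) * (y.2 l - ub N z x l) ^ 2 ∂(Literature.Analysis.FluidPDE.empiricalMeasure z)) / 3 else 0); let q := fun (N : ℕ) (z : Literature.Analysis.FluidPDE.Config (N + 1) (Fin 3) (UnitAddTorus (Fin 3))) (x : (UnitAddTorus (Fin 3))) => ∫ y, (φ N (y.1 - x) * ‖y.2 - ub N z x‖ ^ 2 / 2) • (y.2 - ub N z x) ∂(Literature.Analysis.FluidPDE.empiricalMeasure z); ∀ t : ℝ, 0 < t → ∀ δ : ℝ, 0 < δ → Tendsto (fun N : ℕ => Literature.MathematicalPhysics.KineticTheory.localGibbsLaw σ a₀ u₀ θ₀ N (Φ N) {z | δ < ∫ s in Icc 0 t, ∫ x, ((∑ j, ∑ k, D N ((Φ N).flow s z) x j k ^ 2) + ‖q N ((Φ N).flow s z) x‖ ^ 2)}) atTop (𝓝 0)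

-- earlier EulerRelEntropyDock (stmt-AtomisticToContinuum-14956, replaced 2026-08-16T23:38:51Z -> stmt-AtomisticToContinuum-17823): retired by None — FastMomentRelaxation → CollisionalTransferLocality → AprioriBounds → RelEntropyStability → SecondLawInProbability → DiluteSelfConsistency → _root_.HydrodynamicLimit
/-- item stmt-AtomisticToContinuum-17823 · crux · rank 10 · closed · proved by Summit.AtomisticToContinuum.HydrodynamicLimit.Theorems.MacroClosureLine.StiffDock.eulerRelEntropyDock_proof @ ddc84f46a24e (prover) · by planner
why it might fail: Interface risk only: a hypothesis of RelEntropyStability the five inputs do not produce as typed — G1 (t=0 thermal floor) is a statics lemma, G3 needs η₀ below the analyticity radius; strict |m̄|²<2ρ̄Ē, measurability/x-continuity of block fields — repaired by restating producer/consumer, not a kill.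
sources: Dafermos2005 Thm 5.2.1 + (5.2.14) (relative entropy with defect forcing on 𝕋³), OllaVaradhanYau1993 §1, §3, KipnisLandim1999 Ch. 6, Spohn1991 Part I §3.2–3.3, BerthelinVasseur2005 §3, Summit.AtomisticToContinuum.HydrodynamicLimit.Theorems.ImplosionDichotomyHsEosLowDensity (hsEosLowDensity_proof)
[crux] THE DOCK, rev 5 (route-repair 2026-08-16T23Z after the Statement re-type p126922: the
conjunct is now the packing-GUARDED hydrodynamic limit, ∃η₀ outermost) — FastMomentRelaxation →
CollisionalTransferLocality → AprioriBoundsInBand → RelEntropyStability → SecondLawInProbability →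
HydrodynamicLimit: the macroscopic relative-entropy bookkeeping of the thesis' ## Assembly paragraph
as a typed statement, now FED BY THE STATEMENT'S GUARD instead of the shared dilute-chamber crux
DiluteSelfConsistency (stmt-3091, expected false — DenseExcursion; it leaves the deciding chain
exactly as the route's KILL CRITERIA foresaw: 'closes can then only reach a packing-guarded
conjunct' — which the conjunct now is). PROOF SHAPE (measure theory + Dafermos-type bookkeeping, no
new idea): choose the guard threshold η₀ := min(η₀^conv, η₁, r_an)/2 BEFORE the profiles — η₀^conv
from HsEntropyUniformlyConvex, η₁ from AprioriBoundsInBand (this is why the a-priori crux must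
deliver η₁ uniformly in the profiles: with the per-profile η₁ of stmt-14827 no bookkeeping closes
the gap, the guard scales like the same σ³), r_an the analyticity radius of hsExcessFreeEnergy
(HsEosLowDensity, landed hsEosLowDensit -/
@[route_item "route-AtomisticToContinuum-StiffCollisionalRelaxation", crux]
def EulerRelEntropyDock : Prop :=
  FastMomentRelaxation → CollisionalTransferLocality → AprioriBoundsInBand → RelEntropyStability → SecondLawInProbability → _root_.HydrodynamicLimit

-- earlier AprioriBounds (stmt-AtomisticToContinuum-9519, replaced 2026-08-16T06:33:36Z -> stmt-AtomisticToContinuum-14827): retired by None — ∀ (a₀ θ₀ : (UnitAddTorus (Fin 3)) → ℝ) (u₀ : (UnitAddTorus (Fin 3)) → (EuclideanSpace ℝ (Fin 3))), Continuous a₀ → Continuous θ₀ → Continuous u₀ → (∀ x, 0 < a₀ x) → (∀ x, 0 < θ₀ x) → ∃ σ₀ : ℝ, 0 < σ₀ ∧ ∀ σ : ℝ, 0 < σ → σ < σ₀ → ∀ Φ : (N : ℕ) → Literature.Analy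
/-- item stmt-AtomisticToContinuum-14827 · support · rank 4 · open · by planner
why it might fail: (i) is a time-averaged HighMomentumCutoff before T: no dynamical velocity-tail bound for hard spheres at fixed σ is known; (ii) needs mesoscopic no-evacuation/anti-clustering tracking the Euler flow at scale N^(−γ): unprinted.
sources: OllaVaradhanYau1993 §1 p.525, NachtergaeleYau2003 §2.3 Assumption II.1, Literature.Barriers.AtomisticToContinuum.HighMomentumCutoffBarrier, Summit.AtomisticToContinuum.HydrodynamicLimit.Theorems.AprioriBoundsNegative.AprioriBounds_false_of_PersistentVacuum
[crux] (rev 3 restate by route-choice 2026-08-16: PRE-SHOCK + DILUTE CHAMBER; the rev-1/2 form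
claimed (i)–(ii) for ALL t > 0 and is held by the negative lemmas
AprioriBounds_false_of_PersistentVacuum / AprioriBounds_false_of_PersistentHotSpot — past a Guderley
focus gas dynamics itself evacuates and overheats the centre) for all continuous positive profiles
∃σ₀>0 ∃η₁>0 ∀σ<σ₀, for every classical hs-Euler solution (ρ,u,θ) on [0,T) whose t = 0 fields are the
LLN limit of the local Gibbs laws (the conjunct's own prefix: IsHardSphereEulerSolution +
TendstoHydroFieldsAt … 0), for every flow family and every 0 < t < T such that the solution is
dilute on [0,t] (∀ s ≤ t, ∀ x, 2ρ_s(x)σ³ < η₁): (i) ∃λ>0, C: with probability → 1, ∫₀ᵗ (N+1)⁻¹Σᵢ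
exp(λ|vᵢ(s)|²) ds ≤ C (time-averaged ONE-particle exponential velocity moment); (ii) for every
admissible kernel family (γ ≤ 1/15) ∃c₁>0: with probability → 1, for all s ≤ t and all x, c₁ ≤
ρ̄(s,x) and ρ̄(s,x)σ³ ≤ 1 (no empty and no jammed mesoscopic cell). = Disproof.lean §6 C′
(`AprioriBoundsRepaired`, (i)/(ii) bodies verbatim) + the chamber clause of triage r1-3 C1 (shape of
`AprioriBoundsRepairedDilute` in Cruxes/AprioriBounds/Lines/commutator_matc -/
@[route_item "route-AtomisticToContinuum-StiffCollisionalRelaxation"]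
def AprioriBounds : Prop :=
  ∀ (a₀ θ₀ : (UnitAddTorus (Fin 3)) → ℝ) (u₀ : (UnitAddTorus (Fin 3)) → (EuclideanSpace ℝ (Fin 3))), Continuous a₀ → Continuous θ₀ → Continuous u₀ → (∀ x, 0 < a₀ x) → (∀ x, 0 < θ₀ x) → ∃ σ₀ : ℝ, 0 < σ₀ ∧ ∃ η₁ : ℝ, 0 < η₁ ∧ ∀ σ : ℝ, 0 < σ → σ < σ₀ → ∀ (T : ℝ) (ρ θ : ℝ → (UnitAddTorus (Fin 3)) → ℝ) (u : ℝ → (UnitAddTorus (Fin 3)) → (EuclideanSpace ℝ (Fin 3))), Literature.MathematicalPhysics.KineticTheory.IsHardSphereEulerSolution σ T ρ u θ → ∀ Φ : (N : ℕ) → Literature.Analysis.FluidPDE.HardSphereFlow (Literature.Analysis.FluidPDE.Torus.geometry (Fin 3)) (Literature.MathematicalPhysics.KineticTheory.hsDiameter σ N) (N + 1), Literature.MathematicalPhysics.KineticTheory.TendstoHydroFieldsAt (fun N => Literature.MathematicalPhysics.KineticTheory.localGibbsLaw σ a₀ u₀ θ₀ N (Φ N)) Φ ρ u θ 0 → ∀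 t : ℝ, 0 < t → t < T → (∀ s ∈ Icc 0 t, ∀ x, 2 * ρ s x * σ ^ 3 < η₁) → (∃ lam Cexp : ℝ, 0 < lam ∧ Tendsto (fun N : ℕ => Literature.MathematicalPhysics.KineticTheory.localGibbsLaw σ a₀ u₀ θ₀ N (Φ N) {z | Cexp < ∫ s in Icc 0 t, ∫ y, Real.exp (lam * ‖y.2‖ ^ 2) ∂(Literature.Analysis.FluidPDE.empiricalMeasure ((Φ N).flow s z))}) atTop (𝓝 0)) ∧ (∀ (γ C : ℝ) (φ : ℕ → (UnitAddTorus (Fin 3)) → ℝ), 0 < γ → γ ≤ 1 / 15 → ((∀ N, Literature.Analysis.FunctionSpaces.Torus.IsSmooth (φ N)) ∧ (∀ N y, 0 ≤ φ N y) ∧ (∀ N, ∫ y, φ N y = 1) ∧ (∀ (N : ℕ) y, ((N : ℝ) + 1) ^ (-γ) ≤ Literature.Analysis.FluidPDE.Torus.euclidDist y 0 → φ N y = 0) ∧ (∀ (N : ℕ) y, φ N y ≤ C * ((N : ℝ) + 1) ^ (3 * γ)) ∧ (∀ (N : ℕ) y, ‖Literature.Analysis.FunctionSpaces.Torus.gradient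 (φ N) y‖ ≤ C * ((N : ℝ) + 1) ^ (4 * γ))) → ∃ c₁ : ℝ, 0 < c₁ ∧ Tendsto (fun N : ℕ => Literature.MathematicalPhysics.KineticTheory.localGibbsLaw σ a₀ u₀ θ₀ N (Φ N) {z | ∃ s ∈ Icc 0 t, ∃ x : (UnitAddTorus (Fin 3)), Literature.MathematicalPhysics.KineticTheory.empiricalDensityField ((Φ N).flow s z) (fun y => φ N (y - x)) < c₁ ∨ 1 < Literature.MathematicalPhysics.KineticTheory.empiricalDensityField ((Φ N).flow s z) (fun y => φ N (y - x)) * σ ^ 3}) atTop (𝓝 0))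

/-- item stmt-AtomisticToContinuum-17750 · support · rank 9 · open · by planner
sources: Spohn1991 Part I Ch. 3 (local Gibbs states), Ruelle1969 §3.4, KipnisLandim1999 App. 1, ledger evidence stmt-AtomisticToContinuum-11094: ASSEMBLY_11094_obligations.md §3, AssemblyRepair.lean (prover-pitem-…-11094, 2026-08-16)
[support] (statics at t = 0, size M; obligation G1 of the assembly/dock obligations map — prover
verdict on stmt-11094 2026-08-16T05:08Z, evidence ASSEMBLY_11094_obligations.md +
AssemblyRepair.lean, where a decl of this name and shape elaborated) for all continuous positive
profiles ∃σ₀ ∀σ<σ₀ ∀ flows ∀ admissible kernel families (γ ≤ 1/15) ∃c₂>0: P(∃x, 2ρ̄Ē − ‖m̄‖² < c₂ρ̄²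
at t = 0) → 0 under localGibbsLaw — no mesoscopic block is COLD at time zero (2ρ̄Ē − ‖m̄‖² = 3ρ̄²θ̄,
so θ̄(0,·) ≥ c₂/3 w.h.p. uniformly in x, c₂ ≈ 3 min θ₀/2); a junk-free polynomial event (an empty
block is not flagged: emptiness is AprioriBoundsInBand (ii)). Together with MesoscopicLLN (L²ₓ at t
= 0) and the t = 0 density floor it makes the initial relative entropy ∫h(Ū_N(0)|U_cl(0)) ≤ δ hold
w.h.p. (h is locally quadratic away from the cold direction θ → 0 and grows only linearly on hot
cells) — the one hypothesis of RelEntropyStability that no rev-2–4 antecedent produced (L²ₓ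
convergence alone does not: explicit cold family in the obligations map §3). A LEMMA of the dock's
proof (crux-only rule), filed so that it is claimable. Proof route: under the local Gibbs law the
velocities are conditionally independen -/
@[route_item "route-AtomisticToContinuum-StiffCollisionalRelaxation"]
def TimeZeroThermalFloor : Prop :=
  ∀ (a₀ θ₀ : (UnitAddTorus (Fin 3)) → ℝ) (u₀ : (UnitAddTorus (Fin 3)) → (EuclideanSpace ℝ (Fin 3))), Continuous a₀ → Continuous θ₀ → Continuous u₀ → (∀ x, 0 < a₀ x) → (∀ x, 0 < θ₀ x) → ∃ σ₀ : ℝ, 0 < σ₀ ∧ ∀ σ : ℝ, 0 < σ → σ < σ₀ → ∀ Φ : (N : ℕ) → Literature.Analysis.FluidPDE.HardSphereFlow (Literature.Analysis.FluidPDE.Torus.geometry (Fin 3)) (Literature.MathematicalPhysics.KineticTheory.hsDiameter σ N) (N + 1), ∀ (γ C : ℝ) (φ : ℕ → (UnitAddTorus (Fin 3)) → ℝ), 0 < γ → γ ≤ 1 / 15 → ((∀ N, Literature.Analysis.FunctionSpaces.Torus.IsSmooth (φ N)) ∧ (∀ N y, 0 ≤ φ N y) ∧ (∀ N, ∫ y,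 φ N y = 1) ∧ (∀ (N : ℕ) y, ((N : ℝ) + 1) ^ (-γ) ≤ Literature.Analysis.FluidPDE.Torus.euclidDist y 0 → φ N y = 0) ∧ (∀ (N : ℕ) y, φ N y ≤ C * ((N : ℝ) + 1) ^ (3 * γ)) ∧ (∀ (N : ℕ) y, ‖Literature.Analysis.FunctionSpaces.Torus.gradient (φ N) y‖ ≤ C * ((N : ℝ) + 1) ^ (4 * γ))) → ∃ c₂ : ℝ, 0 < c₂ ∧ Tendsto (fun N : ℕ => Literature.MathematicalPhysics.KineticTheory.localGibbsLaw σ a₀ u₀ θ₀ N (Φ N) {z | ∃ x : (UnitAddTorus (Fin 3)), 2 * Literature.MathematicalPhysics.KineticTheory.empiricalDensityField z (fun y => φ N (y - x)) * Literature.MathematicalPhysics.KineticTheory.empiricalEnergyField z (fun y => φ N (y - x)) - ‖Literature.MathematicalPhysics.KineticTheory.empiricalMomentumField z (fun y => φ N (y - x))‖ ^ 2 < c₂ * Literature.MathematicalPhysics.KineticTheory.empiricalDensityField z (fun y => φ N (y - x)) ^ 2}) atTop (𝓝 0)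

/-- item stmt-AtomisticToContinuum-18068 · support · rank 9 · open · by planner
sources: Spohn1991 Part I Ch. 3 (mesoscopic block averages), Literature.Analysis.FluidPDE.DuchonRobertLocalBalance mollifierKernel / Torus.isSmooth_periodize (tree), GST2013 Ch. 4 intro (minimal-image distance reprSym)
[support] (rev 6, route-repair rbadge g2 2026-08-17; the kernel-existence lemma listed under NOT
DECOMPOSED YET, filed so that it is claimable) for every mesoscopic exponent γ ∈ (0, 1/15] an
ADMISSIBLE KERNEL FAMILY exists: ∃ C, φ : ℕ → 𝕋³ → ℝ with, for all N, φ_N smooth (IsSmooth), ≥ 0,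
mass 1, φ_N(y) = 0 whenever euclidDist y 0 ≥ (N+1)^(−γ), φ_N ≤ C (N+1)^(3γ), ‖∇φ_N‖ ≤ C (N+1)^(4γ) —
the six admissibility clauses quantified over in FastMomentRelaxation / CollisionalTransferLocality
/ AprioriBoundsInBand(ii) / SecondLawInProbability / TimeZeroThermalFloor / MesoscopicLLN VERBATIM
(type-level match checked: planner Sketch3.lean rc 0 instantiates FastMomentRelaxation's kernel
clause from it) — plus evenness φ_N(−y) = φ_N(y) for the foreseen recentred coercivity child
(TWO-LAYER PLAN: even kernels). ROLE: the dock EulerRelEntropyDock / the Assembly must INSTANTIATE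
the ∀-kernel cruxes at γ = 1/15 with one admissible family; without such a family those cruxes would
be vacuous and the dock unprovable — this is the provable construction the thesis calls 'smooth
torus bumps b∘reprSym'. PROOF ROUTE (size S–M): fix a smooth radial bump b ≥ 0 on ℝ³ supported in
the unit ball with ∫b = 1; r -/
@[route_item "route-AtomisticToContinuum-StiffCollisionalRelaxation"]
def AdmissibleKernelsExist : Prop :=
  ∀ γ : ℝ, 0 < γ → γ ≤ 1 / 15 → ∃ (C : ℝ) (φ : ℕ → (UnitAddTorus (Fin 3)) → ℝ), (∀ N, Literature.Analysis.FunctionSpaces.Torus.IsSmooth (φ N)) ∧ (∀ N y, 0 ≤ φ N y) ∧ (∀ N, ∫ y, φ N y = 1) ∧ (∀ (N : ℕ) y, ((N : ℝ) + 1) ^ (-γ) ≤ Literature.Analysis.FluidPDE.Torus.euclidDist y 0 → φ N y = 0) ∧ (∀ (N : ℕ) y, φ N y ≤ C * ((N : ℝ) + 1) ^ (3 * γ)) ∧ (∀ (N : ℕ) y, ‖Literature.Analysis.FunctionSpaces.Torus.gradient (φ N) y‖ ≤ C * ((N : ℝ) + 1) ^ (4 * γ)) ∧ (∀ (N : ℕ)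 y, φ N (-y) = φ N y)

/-- item stmt-AtomisticToContinuum-18213 · support · rank 9 · open · by planner
why it might fail: Pre-collisional correlations at fixed σ³>0 (BoltzmannHypothesisBarrierNarrow): out of equilibrium the contact intensity ρ̄Y(ρ̄σ³) and the isotropy of contact normals may lag the block fields; rattler cages / sub-mesoscopic clustering at bounded entropy cost; ∀t>0 includes post-shock layers.
sources: Spohn1991 Part I §3.2 (3.8)–(3.10), IrvingKirkwood1950, ChapmanCowling1970 §16.4, VanbeijerenErnst1973, Resibois1978, Lutsko1996
[support] (child 2, the MOMENTUM-CHANNEL ENGINE LAW [Kσ]; text =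
`HemisphereAffineSlaving.CollisionalStressLawInline` (Theorems/…DefsD, p140233) = registered stub
`stub_collisionalStressLaw` of the skeleton, `collisionalStressLaw_iff_inline`) for all continuous
positive profiles ∃σ₀ ∃η₁ ∀σ<σ₀ ∀ flow families ∀t>0, [tightness of the
(1+|v_i|+|v_j|)‖Δv‖ε-weighted collision virial on (0,t]] → ∀ admissible mesoscale kernels φ_N (γ ≤
1/15), [w.h.p. no block denser than η₁/σ³ on [0,t]] → ∀ smooth vector tests ψ on [0,t]: uniformly in
τ ≤ t, in local-Gibbs probability, the flux-form EVEN RANK-2 MARK SUM M_N(τ) = (N+1)⁻¹ Σ_{ordered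
contacts, s_c ≤ τ} (ε_N/2)‖Δv_i‖ ω⊗ω:∇ψ(s_c, x_i) equals ∫₀^τ∫ div ψ · p_c(ρ̄,θ̄) + ∫₀^τ∫
(2/5)(D̄:∇ψ)/(ρ̄θ̄) · p_c(ρ̄,θ̄), p_c = hsPressure σ ρ̄ θ̄ − ρ̄θ̄: the mesoscale collisional stress
is ISOTROPIC and the LOCAL thermodynamic function p_c of the block fields (plus the kinetic
correction (2/5)(Z−1)D̄, removed by child 5). Boltzmann–Enskog marked Campbell law along the
non-equilibrium flow, momentum channel. KNOWN REDUCTION (landed, seat c10):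
`collisionalStressLaw_of_evenStress_of_twoScale` — JParityClosure.EvenStressEnskog (stmt-13079,
macroscale radius r) -/
@[route_item "route-AtomisticToContinuum-StiffCollisionalRelaxation"]
def MesoscaleCollisionalStressLaw : Prop :=
  open Literature.MathematicalPhysics.KineticTheory Literature.Analysis.FluidPDE Literature.Analysis.FunctionSpaces in ∀ (a₀ θ₀ : T3 → ℝ) (u₀ : T3 → V3), Continuous a₀ → Continuous θ₀ → Continuous u₀ → (∀ x, 0 < a₀ x) → (∀ x, 0 < θ₀ x) → ∃ σ₀ : ℝ, 0 < σ₀ ∧ ∃ η₁ : ℝ, 0 < η₁ ∧ ∀ σ : ℝ, 0 < σ → σ < σ₀ → ∀ Φ : (N : ℕ) → HardSphereFlow (Torus.geometry (Fin 3)) (hsDiameter σ N) (N + 1), ∀ t : ℝ, 0 < t → let dv := fun (N : ℕ) (w : Config (N + 1) (Fin 3) T3) (i j : Fin (N + 1)) => (w i).2 - (reflectVel ((Torus.geometry (Fin 3)).sepVec (w i).1 (w j).1) ((w i).2, (w j).2)).1; let V := fun (N : ℕ) (z : Config (N + 1) (Fin 3) T3) (τ : ℝ) => ((N : ℝ) +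 1)⁻¹ * (Φ N).collisionPairSum (Ioc 0 τ) (fun (_ : ℝ) (w : Config (N + 1) (Fin 3) T3) (i j : Fin (N + 1)) => hsDiameter σ N * ‖dv N w i j‖ * (1 + ‖(w i).2‖ + ‖(w j).2‖)) z; (∀ δ : ℝ, 0 < δ → ∃ K : ℝ, ∀ᶠ N : ℕ in atTop, localGibbsLaw σ a₀ u₀ θ₀ N (Φ N) {z | K < V N z t} ≤ ENNReal.ofReal δ) → ∀ (γ C : ℝ) (φ : ℕ → T3 → ℝ), 0 < γ → γ ≤ 1 / 15 → ((∀ N, Torus.IsSmooth (φ N)) ∧ (∀ N y, 0 ≤ φ N y) ∧ (∀ N, ∫ y, φ N y = 1) ∧ (∀ (N : ℕ) y, ((N : ℝ) + 1) ^ (-γ) ≤ Torus.euclidDist y 0 → φ N y = 0) ∧ (∀ (N : ℕ) y, φ N y ≤ C * ((N : ℝ) + 1) ^ (3 * γ)) ∧ (∀ (N : ℕ) y, ‖Torus.gradient (φ N) y‖ ≤ C * ((N : ℝ) + 1) ^ (4 * γ))) → let ρb := fun (N : ℕ) (z : Config (N + 1) (Fin 3) T3) (x : T3) => empiricalDensityField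 z (fun y => φ N (y - x)); let mb := fun (N : ℕ) (z : Config (N + 1) (Fin 3) T3) (x : T3) => empiricalMomentumField z (fun y => φ N (y - x)); let Eb := fun (N : ℕ) (z : Config (N + 1) (Fin 3) T3) (x : T3) => empiricalEnergyField z (fun y => φ N (y - x)); let ub := fun (N : ℕ) (z : Config (N + 1) (Fin 3) T3) (x : T3) => (ρb N z x)⁻¹ • mb N z x; let θb := fun (N : ℕ) (z : Config (N + 1) (Fin 3) T3) (x : T3) => 2 / 3 * (Eb N z x / ρb N z x - ‖mb N z x‖ ^ 2 / (2 * ρb N z x ^ 2)); Tendsto (fun N : ℕ => localGibbsLaw σ a₀ u₀ θ₀ N (Φ N) {z | ∃ s ∈ Icc 0 t, ∃ x : T3, η₁ < ρb N ((Φ N).flow s z) x * σ ^ 3}) atTop (𝓝 0) → ∀ ψ : ℝ → T3 → V3, Torus.IsSmoothSpaceTimeOn (Icc 0 t) ψ → let D := fun (N : ℕ) (z : Config (N + 1) (Fin 3) T3) (x : T3) (j k : Fin 3) => (∫ y, φ N (y.1 - x) * ((y.2 j - ub N z x j) * (y.2 k - ub N z x k)) ∂(empiricalMeasure z)) - (if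 j = k then (∑ l : Fin 3, ∫ y, φ N (y.1 - x) * (y.2 l - ub N z x l) ^ 2 ∂(empiricalMeasure z)) / 3 else 0); let pc := fun (r th : ℝ) => hsPressure σ r th - r * th; let nrm := fun (N : ℕ) (w : Config (N + 1) (Fin 3) T3) (i j : Fin (N + 1)) => (Torus.geometry (Fin 3)).sepVec (w i).1 (w j).1; let ω := fun (N : ℕ) (w : Config (N + 1) (Fin 3) T3) (i j : Fin (N + 1)) => ‖nrm N w i j‖⁻¹ • nrm N w i j; let M := fun (N : ℕ) (z : Config (N + 1) (Fin 3) T3) (τ : ℝ) => ((N : ℝ) + 1)⁻¹ * (Φ N).collisionPairSum (Ioc 0 τ) (fun (s : ℝ) (w : Config (N + 1) (Fin 3) T3) (i j : Fin (N + 1)) => hsDiameter σ N / 2 * ‖dv N w i j‖ * ∑ a, ∑ b, ω N w i j a * ω N w i j b * Torus.gradient (fun y => ψ s y a) (w i).1 b) z; let W₁ := fun (N : ℕ) (z : Config (N + 1) (Fin 3) T3) (τ : ℝ) => ∫ s in Icc 0 τ, ∫ x, Torus.divergence (ψ s) x * pc (ρb N ((Φ N).flow s z) x) (θb N ((Φ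 N).flow s z) x); let W₂ := fun (N : ℕ) (z : Config (N + 1) (Fin 3) T3) (τ : ℝ) => ∫ s in Icc 0 τ, ∫ x, 2 / 5 * (∑ a, ∑ b, D N ((Φ N).flow s z) x a b * Torus.gradient (fun y => ψ s y a) x b) / (ρb N ((Φ N).flow s z) x * θb N ((Φ N).flow s z) x) * pc (ρb N ((Φ N).flow s z) x) (θb N ((Φ N).flow s z) x); ∀ δ : ℝ, 0 < δ → Tendsto (fun N : ℕ => localGibbsLaw σ a₀ u₀ θ₀ N (Φ N) {z | ∃ τ ∈ Icc 0 t, δ < |M N z τ - (W₁ N z τ + W₂ N z τ)|}) atTop (𝓝 0)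

/-- item stmt-AtomisticToContinuum-18218 · support · rank 9 · open · by operator
why it might fail: As child 2, plus: the cubic mark ‖Δv‖(V·ω)(ω·∇χ) carries the centre-of-mass velocity, so the sup-τ step needs velocity-tail control beyond 15144; numerically the slowest clause (Disproof §6: |Ce−Re| > |Re| still at Np=32768, decay ∝ Kn).
sources: ChapmanCowling1970 §16.5–16.6, Resibois1978, Spohn1991 Part I §3.2 (3.15)–(3.17), doi:10.1103/physreva.22.2798, Cruxes/CollisionalTransferLocality/Disproof.lean §6 (MD jobs j013836–j014135), Literature.Barriers.AtomisticToContinuum.BoltzmannHypothesisBarrierNarrow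
[crux] [Kq] (split child 5 of CollisionalTransferLocality; NEW; = registered stub
stub_collisionalEnergyFluxLaw, verbatim HemisphereAffineSlaving.CollisionalEnergyFluxLawInline,
certificate collisionalEnergyFluxLaw_iff_inline p140233) THE MESOSCALE COLLISIONAL-ENERGY-FLUX LAW:
for all nice profiles ∃σ₀,η₁ ∀σ<σ₀ ∀Φ ∀t>0, on the virial-tight event [V] and the dilute event, ∀
smooth scalar tests χ: uniformly in τ≤t, in local-Gibbs probability, the flux-form collision sum of
the CUBIC energy mark (ε/2)‖Δv‖(V_cm·ω)(ω·∇χ(x_i)) equals ∫₀^τ∫(∇χ·ū)p_c(ρ̄,θ̄) +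
∫₀^τ∫[(2/5)(D̄ū)·∇χ + (3/5)q̄·∇χ]/(ρ̄θ̄)·p_c(ρ̄,θ̄) — the collisional energy flux is p_c ū (plus the
Enskog kinetic corrections), no collisional heat flux at leading order: the energy half of 9518 in
engine (marked Campbell) form; no sibling item anywhere carries this mark (JParityClosure closes
Euler with exact total energy instead). Equilibrium rung proved (lead c9 wave B1). [difficulty: L] -/
@[route_item "route-AtomisticToContinuum-StiffCollisionalRelaxation"]
def MesoscaleCollisionalEnergyFluxLaw : Prop :=
  ∀ (a₀ θ₀ : (UnitAddTorus (Fin 3)) → ℝ) (u₀ : (UnitAddTorus (Fin 3)) → (EuclideanSpace ℝ (Fin 3))), Continuous a₀ → Continuous θ₀ → Continuous u₀ → (∀ x, 0 < a₀ x) → (∀ x, 0 < θ₀ x) → ∃ σ₀ : ℝ, 0 < σ₀ ∧ ∃ η₁ : ℝ, 0 < η₁ ∧ ∀ σ : ℝ, 0 < σ → σ < σ₀ → ∀ Φ : (N : ℕ) → Literature.Analysis.FluidPDE.HardSphereFlow (Literature.Analysis.FluidPDE.Torus.geometry (Fin 3)) (Literature.MathematicalPhysics.KineticTheory.hsDiameter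 σ N) (N + 1), ∀ t : ℝ, 0 < t → let T := UnitAddTorus (Fin 3); let Cfg := fun N => Literature.Analysis.FluidPDE.Config (N + 1) (Fin 3) T; let P := fun N => Literature.MathematicalPhysics.KineticTheory.localGibbsLaw σ a₀ u₀ θ₀ N (Φ N); let F := fun N (z : Cfg N) s => (Φ N).flow s z; let ε := fun N => Literature.MathematicalPhysics.KineticTheory.hsDiameter σ N; let nrm := fun N (w : Cfg N) i j => (Literature.Analysis.FluidPDE.Torus.geometry (Fin 3)).sepVec (w i).1 (w j).1; let dv := fun N (w : Cfg N) i j => (w i).2 - (Literature.Analysis.FluidPDE.reflectVel (nrm N w i j) ((w i).2, (w j).2)).1; let V := fun N (z : Cfg N) τ => ((N : ℝ) + 1)⁻¹ * (Φ N).collisionPairSum (Ioc 0 τ) (fun _ (w : Cfg N) i j => ε N * ‖dv N w i j‖ * (1 + ‖(w i).2‖ + ‖(w j).2‖)) z; (∀ δ : ℝ, 0 < δ → ∃ K : ℝ, ∀ᶠ N : ℕ in atTop, P N {z | K < V N z t} ≤ ENNReal.ofReal δ) → ∀ (γ C : ℝ) (φ : ℕ → T → ℝ), 0 < γ → γ ≤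 1 / 15 → ((∀ N, Literature.Analysis.FunctionSpaces.Torus.IsSmooth (φ N)) ∧ (∀ N y, 0 ≤ φ N y) ∧ (∀ N, ∫ y, φ N y = 1) ∧ (∀ (N : ℕ) y, ((N : ℝ) + 1) ^ (-γ) ≤ Literature.Analysis.FluidPDE.Torus.euclidDist y 0 → φ N y = 0) ∧ (∀ (N : ℕ) y, φ N y ≤ C * ((N : ℝ) + 1) ^ (3 * γ)) ∧ (∀ (N : ℕ) y, ‖Literature.Analysis.FunctionSpaces.Torus.gradient (φ N) y‖ ≤ C * ((N : ℝ) + 1) ^ (4 * γ))) → let ρb := fun N (z : Cfg N) x => Literature.MathematicalPhysics.KineticTheory.empiricalDensityField z (fun y => φ N (y - x)); let mb := fun N (z : Cfg N) x => Literature.MathematicalPhysics.KineticTheory.empiricalMomentumField z (fun y => φ N (y - x)); let Eb := fun N (z : Cfg N) x => Literature.MathematicalPhysics.KineticTheory.empiricalEnergyField z (fun y => φ N (y - x)); let ub := fun N (z : Cfg N) x => (ρb N z x)⁻¹ • mb N z x; let θb := fun N (z : Cfg N) x => 2 / 3 * (Eb N z x / ρb N z x - ‖mb N z x‖ ^ 2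 / (2 * ρb N z x ^ 2)); Tendsto (fun N : ℕ => P N {z | ∃ s ∈ Icc 0 t, ∃ x : T, η₁ < ρb N (F N z s) x * σ ^ 3}) atTop (𝓝 0) → ∀ χ : ℝ → T → ℝ, Literature.Analysis.FunctionSpaces.Torus.IsSmoothSpaceTimeOn (Icc 0 t) χ → let g := fun s (x : T) (a : Fin 3) => Literature.Analysis.FunctionSpaces.Torus.gradient (χ s) x a; let μ := fun N (z : Cfg N) => Literature.Analysis.FluidPDE.empiricalMeasure z; let D := fun N (z : Cfg N) x j k => (∫ y, φ N (y.1 - x) * ((y.2 j - ub N z x j) * (y.2 k - ub N z x k)) ∂(μ N z)) - (if j = k then (∑ l : Fin 3, ∫ y, φ N (y.1 - x) * (y.2 l - ub N z x l) ^ 2 ∂(μ N z)) / 3 else 0); let q := fun N (z : Cfg N) x => ∫ y, (φ N (y.1 - x) * ‖y.2 - ub N z x‖ ^ 2 / 2) • (y.2 - ub N z x) ∂(μ N z); let pc := fun N (w : Cfg N) x => Literature.MathematicalPhysics.KineticTheory.hsPressure σ (ρb N w x) (θb N w x) - ρb N w x * θb N w x; let ω := fun N (w : Cfg N) i j => ‖nrm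 N w i j‖⁻¹ • nrm N w i j; let M := fun N (z : Cfg N) τ => ((N : ℝ) + 1)⁻¹ * (Φ N).collisionPairSum (Ioc 0 τ) (fun s (w : Cfg N) i j => ε N / 2 * ‖dv N w i j‖ * (inner ℝ ((1 / 2 : ℝ) • ((w i).2 + (w j).2)) (ω N w i j) * ∑ a, ω N w i j a * g s (w i).1 a)) z; let W₁ := fun N (z : Cfg N) τ => ∫ s in Icc 0 τ, ∫ x, (∑ j, g s x j * ub N (F N z s) x j) * pc N (F N z s) x; let W₂ := fun N (z : Cfg N) τ => ∫ s in Icc 0 τ, ∫ x, (2 / 5 * (∑ a, ∑ b, D N (F N z s) x a b * ub N (F N z s) x b * g s x a) / (ρb N (F N z s) x * θb N (F N z s) x) + 3 / 5 * (∑ a, q N (F N z s) x a * g s x a) / (ρb N (F N z s) x * θb N (F N z s) x)) * pc N (F N z s) x; ∀ δ : ℝ, 0 < δ → Tendsto (fun N : ℕ => P N {z | ∃ τ ∈ Icc 0 t, δ < |M N z τ - (W₁ N z τ + W₂ N z τ)|}) atTop (𝓝 0)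

/-- item stmt-AtomisticToContinuum-9524 · support · rank 9 · open · by planner
sources: Ruelle1969, LebowitzPenrose1964, Spohn1991
[support] (statics, low-density cluster expansion; strengthens localGibbs_lln / stmt-0767 to
mesoscopic scale and L²ₓ) for all profiles ∃σ₀ ∀σ<σ₀ ∃ρ₀ continuous > 0 ∀ flows: the local Gibbs
laws are probability measures and for every admissible kernel family the block fields AT TIME 0
converge in L²(𝕋³) in probability to (ρ₀, ρ₀u₀, ρ₀(|u₀|²/2 + 3θ₀/2)). [difficulty: M] -/
@[route_item "route-AtomisticToContinuum-StiffCollisionalRelaxation"]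
def MesoscopicLLN : Prop :=
  ∀ (a₀ θ₀ : (UnitAddTorus (Fin 3)) → ℝ) (u₀ : (UnitAddTorus (Fin 3)) → (EuclideanSpace ℝ (Fin 3))), Continuous a₀ → Continuous θ₀ → Continuous u₀ → (∀ x, 0 < a₀ x) → (∀ x, 0 < θ₀ x) → ∃ σ₀ : ℝ, 0 < σ₀ ∧ ∀ σ : ℝ, 0 < σ → σ < σ₀ → ∃ ρ₀ : (UnitAddTorus (Fin 3)) → ℝ, Continuous ρ₀ ∧ (∀ x, 0 < ρ₀ x) ∧ ∀ Φ : (N : ℕ) → Literature.Analysis.FluidPDE.HardSphereFlow (Literature.Analysis.FluidPDE.Torus.geometry (Fin 3)) (Literature.MathematicalPhysics.KineticTheory.hsDiameter σ N) (N + 1), (∀ N, IsProbabilityMeasure (Literature.MathematicalPhysics.KineticTheory.localGibbsLaw σ a₀ u₀ θ₀ N (Φ N))) ∧ ∀ (γ C : ℝ) (φ : ℕ → (UnitAddTorus (Fin 3)) → ℝ), 0 < γ → γ ≤ 1 / 15 → ((∀ N, Literature.Analysis.FunctionSpaces.Torus.IsSmooth (φ N)) ∧ (∀ N y, 0 ≤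 φ N y) ∧ (∀ N, ∫ y, φ N y = 1) ∧ (∀ (N : ℕ) y, ((N : ℝ) + 1) ^ (-γ) ≤ Literature.Analysis.FluidPDE.Torus.euclidDist y 0 → φ N y = 0) ∧ (∀ (N : ℕ) y, φ N y ≤ C * ((N : ℝ) + 1) ^ (3 * γ)) ∧ (∀ (N : ℕ) y, ‖Literature.Analysis.FunctionSpaces.Torus.gradient (φ N) y‖ ≤ C * ((N : ℝ) + 1) ^ (4 * γ))) → ∀ δ : ℝ, 0 < δ → Tendsto (fun N : ℕ => Literature.MathematicalPhysics.KineticTheory.localGibbsLaw σ a₀ u₀ θ₀ N (Φ N) {z | δ < ∫ x, ((Literature.MathematicalPhysics.KineticTheory.empiricalDensityField z (fun y => φ N (y - x)) - ρ₀ x) ^ 2 + ‖Literature.MathematicalPhysics.KineticTheory.empiricalMomentumField z (fun y => φ N (y - x)) - ρ₀ x • u₀ x‖ ^ 2 + (Literature.MathematicalPhysics.KineticTheory.empiricalEnergyField z (fun y => φ N (y - x)) - Literature.MathematicalPhysics.KineticTheory.totalEnergyDensity (ρ₀ x) (u₀ x) (θ₀ x)) ^ 2)}) atTop (𝓝 0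)

/-- item stmt-AtomisticToContinuum-9525 · support · rank 9 · open · by planner
sources: Ruelle1969, LebowitzPenrose1964, Dafermos2005
[support] (statics; strengthens HsEntropyConvex stmt-0817 from strict to strong convexity and adds
C²-regularity, both from HsEosLowDensity stmt-0768: f_ex analytic near 0 with f′(0) = 2π/3 ⇒ (ηZ)′ >
0 ⇒ positive-definite Hessian) ∃η₀>0: hsExcessFreeEnergy is C² on (0, η₀) and for all σ, c₁ > 0 and
E₁ there is m > 0 with η_σ − m(ρ² + |m|² + E²) convex on {c₁/2 < ρ, ρσ³ < η₀, |m|² < 2ρE, E < E₁}.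
[difficulty: M] -/
@[route_item "route-AtomisticToContinuum-StiffCollisionalRelaxation"]
def HsEntropyUniformlyConvex : Prop :=
  ∃ η₀ : ℝ, 0 < η₀ ∧ ContDiffOn ℝ 2 Literature.MathematicalPhysics.KineticTheory.hsExcessFreeEnergy (Set.Ioo 0 η₀) ∧ ∀ σ c₁ E₁ : ℝ, 0 < σ → 0 < c₁ → ∃ m : ℝ, 0 < m ∧ ConvexOn ℝ {U : ℝ × (EuclideanSpace ℝ (Fin 3)) × ℝ | c₁ / 2 < U.1 ∧ U.1 * σ ^ 3 < η₀ ∧ ‖U.2.1‖ ^ 2 < 2 * U.1 * U.2.2 ∧ U.2.2 < E₁} (fun U : ℝ × (EuclideanSpace ℝ (Fin 3)) × ℝ => -(U.1 * (3 / 2 * Real.log (2 / 3 * (U.2.2 / U.1 - ‖U.2.1‖ ^ 2 / (2 * U.1 ^ 2))) - Real.log U.1 - Literature.MathematicalPhysics.KineticTheory.hsExcessFreeEnergy (U.1 * σ ^ 3))) - m * (U.1 ^ 2 + ‖U.2.1‖ ^ 2 + U.2.2 ^ 2))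

/-- item stmt-AtomisticToContinuum-9526 · support · rank 9 · closed · proved by Summit.AtomisticToContinuum.HydrodynamicLimit.Theorems.MacroClosureLine.Barycentric.stub_hsFreeEnergyConvex (prover) · by planner
sources: Ruelle1969, Dafermos2005
[support] (statics beyond the virial radius: Ruelle convexity of the free-energy density η ↦ η log η
+ η·hsExcessFreeEnergy(η) on (0, 1.1) ⊂ (0, √2), transported to conserved variables by the
perspective lemma; non-strict, phase transition allowed) for every σ > 0, η_σ is convex on {0 < ρ,
ρσ³ < 11/10, |m|² < 2ρE}. [difficulty: M] -/
@[route_item "route-AtomisticToContinuum-StiffCollisionalRelaxation"]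
def HsFreeEnergyConvex : Prop :=
  ∀ σ : ℝ, 0 < σ → ConvexOn ℝ {U : ℝ × (EuclideanSpace ℝ (Fin 3)) × ℝ | 0 < U.1 ∧ U.1 * σ ^ 3 < 11 / 10 ∧ ‖U.2.1‖ ^ 2 < 2 * U.1 * U.2.2} (fun U : ℝ × (EuclideanSpace ℝ (Fin 3)) × ℝ => -(U.1 * (3 / 2 * Real.log (2 / 3 * (U.2.2 / U.1 - ‖U.2.1‖ ^ 2 / (2 * U.1 ^ 2))) - Real.log U.1 - Literature.MathematicalPhysics.KineticTheory.hsExcessFreeEnergy (U.1 * σ ^ 3))))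

-- earlier Assembly (stmt-AtomisticToContinuum-11094, replaced 2026-08-16T23:58:52Z -> stmt-AtomisticToContinuum-18058): proved by Summit.AtomisticToContinuum.HydrodynamicLimit.Theorems.collisionIsometryCLT_assembly_proof @ 5036f6857728 — FastMomentRelaxation → CollisionalTransferLocality → AprioriBounds → RelEntropyStability → SecondLawInProbability → MesoscopicLLN → HsEntropyUniformlyConvex → HsFre
-- earlier Assembly (stmt-AtomisticToContinuum-18058, replaced 2026-08-17T00:02:51Z -> stmt-AtomisticToContinuum-18061): retired by None — EulerRelEntropyDock → FastMomentRelaxation → CollisionalTransferLocality → AprioriBoundsInBand → RelEntropyStability → SecondLawInProbability → _root_.HydrodynamicLimit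
-- earlier Assembly (stmt-AtomisticToContinuum-9528, replaced 2026-08-15T16:43:05Z -> stmt-AtomisticToContinuum-11094): retired by None — FastMomentRelaxation → CollisionalTransferLocality → AprioriBounds → RelEntropyStability → SecondLawInProbability → MesoscopicLLN → HsEntropyUniformlyConvex → HsFreeEnergyConvex → NoImplosion → HydrodynamicLimit
/-- item stmt-AtomisticToContinuum-18061 · assembly · rank 1 · closed · proved by Summit.AtomisticToContinuum.HydrodynamicLimit.Theorems.MacroClosureLine.StiffDock.stiffAssembly_proof @ bc8c873ee8d2 (prover) · by planner
sources: Dafermos2005 Thm 5.2.1 + (5.2.14), KipnisLandim1999 Ch. 6, Spohn1991 Part I §3.2–3.3, OllaVaradhanYau1993 §1, §3, BerthelinVasseur2005 §3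
[assembly] (rev 6b, route-repair rbadge g2 2026-08-17) MesoscopicLLN → TimeZeroThermalFloor →
HsEntropyUniformlyConvex → HsFreeEnergyConvex → FastMomentRelaxation → CollisionalTransferLocality →
AprioriBoundsInBand → RelEntropyStability → SecondLawInProbability → HydrodynamicLimit — the D-0019
assembly shape "cruxes + supports → Statement": the macroscopic relative-entropy bookkeeping of the
dock EulerRelEntropyDock (17823) with the four statics supports as EXPLICIT antecedents instead of
lemmas (guard threshold η₀ := min(η₀^conv, η₁, r_an)/2 chosen before the profiles, η₀^conv now read
off the hypothesis HsEntropyUniformlyConvex, r_an from the landed HsEosLowDensity; every hypothesis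
of RelEntropyStability produced on a good event from the four in-probability inputs, t = 0 relative
entropy from MesoscopicLLN + TimeZeroThermalFloor + AprioriBoundsInBand(ii), L¹-closeness ⇒
TendstoHydroFieldsAt). RELATIONS (planner Sketch2.lean rc 0): EulerRelEntropyDock → Assembly (drop
the statics antecedents) and Assembly → MesoscopicLLN → TimeZeroThermalFloor →
HsEntropyUniformlyConvex → HsFreeEnergyConvex → EulerRelEntropyDock (one line each) — so this item
is the dock's deterministic-plus-prob -/
@[route_item "route-AtomisticToContinuum-StiffCollisionalRelaxation"]
def Assembly : Prop :=
  MesoscopicLLN → TimeZeroThermalFloor → HsEntropyUniformlyConvex → HsFreeEnergyConvex → FastMomentRelaxation → CollisionalTransferLocality → AprioriBoundsInBand → RelEntropyStability → SecondLawInProbability → _root_.HydrodynamicLimit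

/-! D-0027 §2.1 — DECIDING THEOREM (planner-authored via `route open/edit --closes-file`; by planner-rbadge-AtomisticToContinuum-StiffColli-e8e21589-g2-0 2026-08-17T00:06:15Z):
its hypotheses are this route's items and its conclusion the sub-problem Statement (glue_lint), and it elaborates with this file. -/

/-- D-0027 §2.1 deciding theorem, rev 6 (route-repair rbadge g2, 2026-08-17; statement and proof
unchanged from rev 5). `_root_.HydrodynamicLimit` is the PACKING-GUARDED conjunct (`∃ η₀ > 0`
outermost, guard `∀ t ∈ Ico 0 T, ∀ x, ρ t x * σ ^ 3 < η₀` on the classical solution). Crux-only, six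
binders; the guard is SUPPLIED BY THE DOCK `EulerRelEntropyDock`, whose proof chooses the threshold
η₀ := min(η₀^conv, η₁, r_an)/2 before the profiles (η₀^conv from `HsEntropyUniformlyConvex`, η₁ from
the UNIFORM a-priori crux `AprioriBoundsInBand`, r_an the analyticity radius of `hsExcessFreeEnergy`).
Rev 6: the route's `Assembly` item (not a binder here) is the dock's bookkeeping with the four
statics supports as explicit antecedents (`EulerRelEntropyDock → Assembly`, and `Assembly` plus the
statics gives the dock back); the rev-2 chain through `AprioriBounds`/`DiluteSelfConsistency` with
its mis-attributed closure record is retired, and the shared `DiluteSelfConsistency` (stmt-3091) and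
the `Theorems.CollisionIsometryCLTAssembly` import have left the route. -/
@[closes "route-AtomisticToContinuum-StiffCollisionalRelaxation"] theorem closes (hD : EulerRelEntropyDock) (hF : FastMomentRelaxation)
    (h₂ : CollisionalTransferLocality) (h₃ : AprioriBoundsInBand) (h₄ : RelEntropyStability)
    (h₅ : SecondLawInProbability) : _root_.HydrodynamicLimit :=
  hD hF h₂ h₃ h₄ h₅

end Summit.AtomisticToContinuum.HydrodynamicLimit.Theses.StiffCollisionalRelaxation
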